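import Summits.BirchSwinnertonDyer.BirchSwinnertonDyer.Theses.TwoAdicConverse
import Summits.BirchSwinnertonDyer.BirchSwinnertonDyer.Theorems.TwoAdicConverseLambdaHalfDefs
import Literature.NumberTheory.EllipticCurves.KatoKolyvaginPrimes
import Literature.NumberTheory.EllipticCurves.KuriharaNumber
import Summits.BirchSwinnertonDyer.BirchSwinnertonDyer.Theorems.OrdLambdaHalfAtTwo.Negative.UnitKuriharaWitnessLevelOne
import Summits.BirchSwinnertonDyer.BirchSwinnertonDyer.Theorems.OrdLambdaHalfAtTwo.Negative.UnitKuriharaWitnessEvenValues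
import Summits.BirchSwinnertonDyer.Rank1Residual.Supersingular.KuriharaNumberModTwoVanishing
import Summits.BirchSwinnertonDyer.BirchSwinnertonDyer.Theorems.TwoAdicConverseOrdLambdaHalfAtTwoPinnedDatumDefs
import Summits.BirchSwinnertonDyer.BirchSwinnertonDyer.Theorems.TwoAdicConverseOrdLambdaHalfAtTwoShapiroDatumKernel
import Summits.BirchSwinnertonDyer.BirchSwinnertonDyer.Theorems.OrdLambdaHalfAtTwo.Negative.PinnedSupplyMuDefect
import HarnessLib

/-!
# Disproof of `OrdLambdaHalfAtTwo` (crux `stmt-BirchSwinnertonDyer-19556`, route `TwoAdicConverse`, S3) — findings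

Standing disprover's work file (cdisprove seats `cdisprove-stmt-BirchSwinnertonDyer-19556-g0` (F0–F6, DATA (1)–(5)) and `-g1`
(F7–F10, DATA (6)–(7), `-- Targets` for the PICKED line `kato_determinant_greenberg_two` v4.2/v4.3).  Prose only in
docstrings.  **No kill of the crux is claimed; BSD is not proved by any of this.**

## F0 — the crux is interface-honest (no junk model, no vacuity)
`OrdLambdaHalfAtTwo W`-instances quantify over `D : W.SelmerDualData κ γ` (pinned to `W.selmerInfty κ`, `toDual`
bijective — no junk `D`), `padicLFunction f α = PowerSeries.mk (padicLCoeff f α)` (honest Mazur–Tate–Teitelbaum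
sums), `MuLambda.lam` (honest distinguished-polynomial degree).  The conclusion `λ(L₀) ≤ λ(X)` has NO computable
upper bound on the algebraic side (`2` is anomalous for every good-ordinary curve; `μ`-entangled descent), so a
numerical `¬ OrdLambdaHalfAtTwo` is out of reach; the statement is a consequence of IMC₂ and is believed true.
Cheap attacks therefore go to the LINES (ideas) and their supply statements.

## F1 — load-bearing hypotheses (typed; none refutable in-tree)
`OrdLambdaHalfAtTwoWithoutNewform` (drop `IsNewformOf W f`): false at `f = 0` as soon as the prefix data
`(W, κ, γ, D)` is inhabited (`padicLFunction 0 α = 0`, `ι` injective) — a refutation needs `Nonempty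
(W.SelmerDualData κ γ)` for a concrete `W`, not constructible here; recorded as a typed `Prop` only.
`¬ W.HasCM`, `GoodOrd W 2`/`IsOrdinaryAt W 2`, the cyclotomic normalisations: no cheap model separates them
(a CM curve ordinary at `2`, e.g. CM by `ℤ[(1+√−7)/2]`, would need its 2-adic `L` computed in-tree).

## F2 — line `two-power-slack-rigidity-two` (card + sketch `TwoPowerSlackRigidityTwoSketch.lean`), SUPPLY side
LANDED (p651356, `Theorems/OrdLambdaHalfAtTwo/Negative/UnitKuriharaWitnessLevelOne.lean`): for every cusp form
`f`, scaling `c`, level `k ≥ 1`, `n > 2` with all prime factors `≡ 1 (mod 4)` and all discrete logs `ψ`,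
`kuriharaNumberScaled f c k n ψ` is NOT a unit (involution `a ↔ −a` after reducing `ψ` mod `2`); hence a unit
witness for a Kolyvagin product of level `k` has `k = 1 ∨ n = 1` (`level_eq_one_or_eq_one_of_isUnit`).
Here, for the sketch's names: `kuriharaNumberScaled_not_isUnit_of_two_le` and the REDUCTION
`unitKuriharaWitnessAtTwo_iff_levelOne`: `UnitKuriharaWitnessAtTwo W f` is EQUIVALENT to the existence of a
LEVEL-ONE (`ℤ/2`-valued) unit witness — the "2-power slack" supply statement has no 2-adic depth at all: it is a
parity statement about `∑_{a ∈ (ℤ/n)ˣ, a non-residue mod every ℓ ∣ n} c·[a/n]⁺_f` for square-free `n` of level-1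
Kato–Kim primes (`ℓ ∤ 2N`, `a_ℓ` even), and (`levelOne_witness_shape`) any such witness with `n ≠ 1` has `n > 2`
and a prime factor `ℓ ≡ 3 (mod 4)`.

## F3 — natural strengthening refuted
`not_exists_unit_witness_of_two_le`: there is NO `(W, f, c, k, n, ψ)` with `k ≥ 2`, `n ≠ 1` a Kolyvagin product of
level `k` at `2`, and `kuriharaNumberScaled f c k n ψ` a unit.  (Kim's higher-level numbers `δ_n`, `n ∈ 𝒩_k`,
`k ≥ 2`, carry no unit information at `p = 2`.)

## F4 — the batched falsifier job (F1 of the director's brief): method and typed exclusions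
ONE batched kit job (`job/`: engine A = PARI/GP `msfromell` exact symbols; engine B = Sage 10.9/eclib, disjoint code;
smokes j313310, j313728, j313889, j313929; production j314084 and r2 j314211 (authoritative), 70 curves = E5 head class 65a1·145a1·689a1·1585a1·
1745a1·4033a1·5105a1·7985a1·9089a1, the six `N = 9q` pairs, the 20 «both» curves, 18 further E5 curves, 11 print
controls) computes per curve: the primitive scaling `q₀` (generator of the value lattice `x⁺(Δ₀)`, from
`mspathgens` resp. Manin symbols — the two engines agree), the RIGOROUS boundary flag `boundaryG` (is
`γ ↦ Λ{∞,γ∞} mod 2`, `Λ = x⁺/q₀`, zero on a generating set of `Γ₀(N)` — PARI `mspolygon` pairing matrices resp.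
Sage `Gamma0(N).gens()`; the two engines agree), a Hecke self-check, the parity of the level-one numbers
`u(n) = ∑_{a QNR mod every ℓ∣n} Λ(a/n)` for `n ∈ {ℓ ≤ L1} ∪ {ℓ₁ℓ₂ : ℓᵢ ≤ L2} ∪ {ℓ₁ℓ₂ℓ₃ ≤ N3} ∪ {ℓ₁…ℓ₄ ≤ N4}` over
level-1 Kato–Kim primes (by F2 this is the WHOLE content of `UnitKuriharaWitnessAtTwo`), the EXACT `(μ, λ)`
reading of `L₂(E)` modulo `ω_n` (`n = 5, 6, 7`; valid as `(μ, λ)` if `λ < 2^n`) in both engines, and odd-twist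
`λ`'s for the `kato-determinant` card (PARI's `mspadicseries` reading was dropped: `s`-series, lossy conversion).
Typed here: `NoLevelOneUnitWitnessOn W f S` (bounded exclusion) and — the structural outcome — F6.

## F5 — line `kato-determinant-greenberg-two` (falsifier (c) of the director's brief)
The Poitou–Tate identity `hPT` is not numerically testable here (its local/error terms `e, e′` are unbooked and
`gAlg` needs class groups of the layers `Kℚ_n`); the job delivers only the elliptic-side inputs `λ(L₂(E))`,
`λ(L₂(E^{(d)}))` for `(15a1, −7/−71)`, `(65a1, −79)`, `(145a1, −71)`, `(17a1, −47/−15)`, `(73a1, −23)`,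
`(603a1/b1, −95)`, `(E1169, −55)`.  Presearch (Q3, Katz/BDP at `p = 2`): see the `presearch:` lines in the seat's
NOTES.md and the crux item's evidence (triage r2-1 already located Kriz–Li, FMS 2019, Lemma 7.6/Thm 7.1 for the
CM-point congruence at `2`; a two-variable `Λ_K`-adic 2-adic `L` for non-CM `f`, `2` split, remains unlocated).

## F6 — per-curve COUNTEREXAMPLES to the line's SUPPLY statement `UnitKuriharaSupplyAtTwo` (evidence tier)
LANDED (p653405, `Negative/UnitKuriharaWitnessEvenValues.lean`): if some value `[r₀]⁺_f` is `q₀·odd` and every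
value at a rational with denominator prime to `2N_W` is `q₀·even` (`EvenClassAtTwo W f` below), then
`¬ UnitKuriharaWitnessAtTwo W f` — no scaling, level, Kolyvagin product or logarithms give a unit.  By the
homomorphism argument (`boundaryG = 1` ⇒ `Λ mod 2` is a function of the `Γ₀(N)`-class of the cusp; every `a/n`,
`(n, N) = 1`, is in the class of `0`) the hypothesis holds for every curve with `boundaryG = 1 ∧ Λ(0) even`, in
particular for every POSITIVE-RANK curve with `boundaryG = 1`.  MEASURED (both engines, exact): `65a1` (rank 1,
non-CM, good ordinary at 2, HEAD of the E5 collision class, `λ^an_2 = 2`), `603a1`, `603b1` (rank 0, `Λ(0) = 2`).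
So `UnitKuriharaSupplyAtTwo` is FALSE as stated (typed: `unitKuriharaSupplyAtTwo_false_of_data`; the in-tree gap is
only the evaluation of `ratPlusSymbol f` for the newform of `65a1`, i.e. `IsNewformOf` + Manin–Drinfeld values — a
`sorry`d near-miss `unitKuriharaSupplyAtTwo_false` records it).  Curves with `boundaryG = 0` (`145a1`, `9089a1`,
`73a1`, `E1169`, …) are untouched by F6; for them only the bounded search speaks (DATA (3): witnesses for 33/37, and a
second, real-twist obstruction stratum 725a1/8725a1/8957a1 + E1169 with none).  REPAIR HINT for the line:
restrict the supply statement to curves whose `2`-primitive plus symbol is NOT Eisenstein mod `2` on the class of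
`0` (equivalently: ask for the unit in `δ^{(c)}_n` with `c = 1/(2q₀)` on the `boundaryG = 1` stratum, i.e. one more
halving — which is exactly where the «slack» `s(E)` of the card lives), or replace unit-ness by the exact
`2`-adic valuation predicted by `s(E)`.

## F7 — PICKED line `kato_determinant_greenberg_two` (skeleton v4.2): junk / vacuity audit of `PinnedKatoGreenbergDatum` and of the
## stubs 4′ `PinnedKatoGreenbergSupplyAtTwo`, 6′ `PinnedGreenbergDivisibilityAtTwo` (pen RC-351 (6), RECUT2 memo)
(a) NO JUNK DATUM.  The carriers of a `P : PinnedKatoGreenbergDatum I_W I_A J J' J_A uA hsurj hγ hγᵥ DGr Dfi L₀ L₀' b b'` are the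
tree's PINNED objects (`IwasawaH1Data`: `proj_injective`/`proj_surjective` onto norm-compatible integral families, `proj_T_smul`;
`LocalIwasawaH1Data` likewise; JUNK LEDGER of the v4 Defs), `δ : J.H ⧸ range(loc_W ⊕ u_A loc_A) →ₗ DGr.X` and `π : DGr.X →ₗ Dfi.X`
are typed against the GENUINE `X_Gr`, `X_fine`, and `katoIndex` ties `b, b'` to them; `colMinus_coker : Finite (Λ ⧸ range Col⁻)`
excludes `Col⁻ = 0`.  So 4′ cannot be inhabited by a zero/`PUnit` model and 6′ cannot be falsified by one.
(b) 6′ IS `P`-INVARIANT, hence immune to junk in both directions: `PinnedKatoGreenbergDatum.gD_le_lambda_iff` gives, for every `P`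
with `X_Gr` f.g. torsion, `P.gD ≤ λ(X_Gr) ↔ lam L₀ + lam L₀' ≤ D.lambda + DA.lambda` — 6′ is EXACTLY "crux(`E`) + crux(`E^K`) in
`λ`-currency" summed (Defs TRANSPARENCY).  A kill of 6′ is a kill of `OrdLambdaHalfAtTwo` for `W` or for its twist `A`, i.e. out of
reach by F0; cdisprove can only attack 6′ THROUGH ITS INSTANCES' VACUITY, which is (c).
(c) 4′ IS EMPTY ON HALF THE HABITAT — stub-misstated (LANDED p680224, `Negative/PinnedSupplyMuDefect.lean`; evidence
`stub_pinnedKatoGreenbergSupplyAtTwo.md` on the item).  Kernel: `δ_injective` forces `μ(J.H ⧸ range(loc_W ⊕ u_A loc_A)) ≤ μ(DGr.X)`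
(`muInvariant_quot_le_of_pinnedKatoGreenbergDatum`), so the datum type is EMPTY whenever `μ(DGr.X) < μ(J.H ⧸ range …)`
(`isEmpty_pinnedKatoGreenbergDatum_of_muInvariant_lt`) and 4′ is false at any admissible instance carrying that defect
(`pinnedKatoGreenbergSupplyAtTwo_false_of_muDefect`); 6′ then holds there VACUOUSLY (`stub6'_vacuous_of_muDefect` below).  Print
half (triage r1-1 GEN 17 Δ16-1/Δ17-1, not asserted in Lean): on `{Δ_W < 0}` the Shapiro cokernel
`C ↪ 𝐇¹_Iw(ℚ_∞, E[2])` has `Ω`-rank `2 − dim E(ℝ)[2] = 1` (given `μ(𝐇²) = 0`) and `loc` is injective, so `μ(J.H ⧸ range) ≥ 1 > 0 =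
μ(X_Gr)` (B2): every (β)-curve with `discsign = −1` (17a1, 113a1, 353a1, 593b1, 1153a1, 2273a1, …) is OUTSIDE the reach of 4′ as typed.
REPAIR (the lead's R1/R2, cdisprove concurs; the witness misses both): R1 saturate `range(loc ⊕ loc)` in `J.H` before the quotient;
R2 replace `δ, δ_injective, π, π_surjective, exact_δ_π` by the `λ`-identity `λ(J.H ⧸ range^sat) + λ(X_fine) = λ(X_Gr) (+ c)` they serve.
(d) No natural strengthening of 6′ is decidable in-tree (all its instances quantify over `SelmerDualData`/newforms); none attempted.
(e) v4.3 RESHAPE (lead, Defs p679221 / kernel p679569; skeleton now carries 4″ `stub_shapiroKatoGreenbergSupplyAtTwo`, 6″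
`stub_shapiroGreenbergDivisibilityAtTwo`): the Poitou–Tate source is `𝐇¹_loc ⧸ L` for a SHAPIRO LATTICE `L` with `range(loc ⊕ loc) ≤ L`,
`2·L ≤ range` — i.e. repair R1.  Re-audit (p680711, same Negative file, §4): the kernel constraint transposes verbatim,
`μ(J.H ⧸ S.L) ≤ μ(X_Gr)` for every `S : ShapiroKatoGreenbergDatum …` (`muInvariant_quotL_le_of_shapiroKatoGreenbergDatum`), so 4″ needs at
every instance a sandwiched lattice with `μ(𝐇¹_loc ⧸ L) = 0` (B2) — exactly the print input of triage Δ17-1/Δ17-2 for the genuine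
`L = loc_w̄ H¹_Iw(K_Σ/K, T₂W)`, available on BOTH signs of `Δ_W`; the `μ`-witness of (c) does NOT bite 4″ (it bites only `L = range`, which 4″ no
longer forces).  NO JUNK FREEDOM in `L`: `δ_injective ∧ exact_δ_π` pin `L = ker(𝐇¹_loc → X_Gr)` at print level; `gD` does not mention `L`, and
`ShapiroKatoGreenbergDatum.gD_le_lambda_iff` keeps 6″ `S`-invariant (= crux pair in `λ`-currency; vacuous exactly where 4″ is empty:
`stub6''_vacuous_of_forall_muDefect`).  Verdict on v4.3: 4″ construction/print grade with the typed `μ = 0` obligation, 6″ = the crux pair; no cheap kill.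

## F8 — primitivity probe on 6′ (pen RC-351 (6)): NO `_false_without_primitivity`
Dropping primitivity of the Greenberg Selmer structure at `v ∣ N` (imprimitive local conditions) only ENLARGES the dual Selmer module:
`λ(X_Gr^imp) = λ(X_Gr) + Σ_v δ_v ≥ λ(X_Gr)` (Greenberg–Vatsal 2000 §2, Prop. 2.4-shape; at `p = 2` over `K_∞` the local terms are
Matsuno-type and include `v ∣ ∞`-free, `v = w̄` contributions).  Hence the inequality `gD ≤ λ(X_Gr)` WITHOUT primitivity is WEAKER than
6′, not false: primitivity is load-bearing only for an exact count (the line's B3a `λ(X_Gr) = 2 d_S − ε − t_∞ − t_w − dim F[2] − Σ δ_v`),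
never for 6′.  The one hypothesis of 6′ whose removal is visible in-tree is `Module.Finite ∧ Module.IsTorsion (X_Gr)` inside
`gD_le_lambda_iff` (without it `lambdaInvariant` is junk `0` and 6′ says `gD = 0`); it is supplied by the line's B2, not attackable here.

## F9 — FIRST-RUNG GL(1) table (pen RC-351 (3); memo RECUT2-kato_determinant_greenberg_two-stub6prime-GL1.md §3(D)): engines, status,
## and what the table can test
ENGINES (seat folder `job/`, sha256 in the job MANIFEST): R = `gl1.gp` (PARI `bnfinit`/`bnrinit` over the layers
`K_n = ℚ(√−D, ζ_{2^{n+2}} + ζ̄)` of `K_∞/K`, `n ≤ 3` (`4` for five fields): `d(T,U) = rk₂ Cl_𝔪(K_n)/⟨Frob_U⟩`,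
`𝔪 = ∏_{𝔩 ∈ T odd} 𝔩 · ∏_{𝔭 ∈ T dyadic} 𝔭^{2e+1}`; menu BDP = `(S ∪ {w̄}, {w})` [the memo's `d_S`], SYM = `(S ∪ {w}, {w̄})` [control,
= BDP by complex conjugation], BDPns, BDP0, W0, ORD = `(S ∪ {w, w̄}, ∅)` [Λ-rank-1 growth control], UNR, TAME, CL [= `rk₂ bnf.cyc`
control]; `E(K_n)[2^∞]`; GRH-conditional above degree 4), L = `loc.gp` (`E(F_n)[2^∞]`, `F_n = ℚ₂(ζ_{2^{n+2}})⁺ = K_{n,w}`: exact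
digit-tree root isolation with Hensel certificates + dyadic Hilbert-symbol square test), A-lite = `tw.gp` (`λ(L₂E)`, `λ(L₂E^{(−D)})` by
the exact MSD readings of DATA (1)/(4)); 30 curves (HEAD 65a1 145a1 689a1 1585a1 1745a1; the six `N = 9q`; eleven «both»; six E5OTHER;
controls 15a1, E1169) × `D ∈ {7,15,23,31,39,47,55,71,79,95}` at the admissible (Heegner for `2N`) pairs.
STATUS: smoke j320785 (2 fields, `n ≤ 1`, 6 curves) VALIDATED engines L and A-lite (DATA (6): all `λ` readings reproduce j314211; local
torsion certified) and exposed a GP lexer bug in engine R (`x.e+1` is read as a real constant; fixed, `gl1.gp` @7e7d057f→ new sha in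
`job/`); THE batched run (10 fields × `n ≤ 3`, five at `n = 4`, ≈ 40 core-h requested ≤ 100) is NOT YET SUBMITTED — the seat's one-job
grant was spent on the smoke (seat error, 0.0 core-h); director-bsd g16 ruling (314)(4) granted ONE more submission and THE batched run
is kit **j321331** (done rc 0, 16 cores, 41 min wall, 115 tasks, ERR 0, TIMEOUT 0) — RESULTS IN F10 / DATA (7) below.
WHAT THE TABLE CAN AND CANNOT TEST (analysis, for D3/the lead): under `hPT` + IMC the line's `λ(X_Gr) = gD` is the BDP/`Col⁺`-side
invariant of `E/K_∞` (anticyclotomic-flavoured local condition at `w | 2`: unramified at `w̄`-side, relaxed/strict split); it has NO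
classical analytic handle at `p = 2` for non-CM `E` (F5), and the memo's comparison target `λ(L₂E) + λ(L₂E^K) − g` is the ORDINARY
structure's count (`= λ(X_ord(E/K_∞))` under IMC(E) ∧ IMC(E^K)), related to `X_Gr` only through a two-variable main conjecture, not by a
finite-layer identity — so "d_S vs λ + λ′ − g" is NOT a falsifier of B3a.  What the rows DO test: (i) STABILISATION of `d_S(n)`
(`X_Gr` torsion with `μ = 0` ⇒ `d_S(n)` eventually constant = `λ`-type; linear growth in `2^n` would REFUTE B2's torsion-ness for that
pair — a genuine kill switch for the line at that instance); (ii) the controls SYM = BDP, CL = `rk₂ Cl`, ORD growth `~ [K_{n,w}:ℚ₂]`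
(rank one); (iii) the sign/parity sanity `2 d_S − (corrections) ≥ 0` and `≡ λ(X_Gr) (mod 2)` predictions against root numbers
`w(E) w(E^K)`; (iv) the local columns `t_w(n) = log₂ |E(F_n)[2^∞]|` (engine L) and `E(K_n)[2^∞]`, `dim E(K_n)[2]` (engine R) that any
calibration of B3a needs.  Calibrating `ε, t_∞, Σδ_v` themselves is D3's print work (Greenberg–Vatsal (2.3)/Prop. 2.4 at `p = 2`, Matsuno
2008 §4), owed, not done here.

## DATA (production kit j314084 + r2 j314211, 70 curves; A = PARI/GP `msfromell`, B = Sage 10.9/eclib; MANIFEST.sha256 in each job's outputs)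
(1) `(μ, λ)` of `2^s·L₂(E)` read EXACTLY mod `ω_n`, `n = 5, 6, 7` (stable), engines A and B AGREE ON ALL 70 CURVES and with
the j270470 table wherever it has an entry (proviso: the reading is `(μ, λ)` if `λ < 2^7`).  HEAD class:
`65a1 λ=2 · 145a1 4 · 689a1 14 · 1585a1 6 · 1745a1 6 · 4033a1 2 · 5105a1 4 · 7985a1 10 · 9089a1 2` (all rank 1).
Observed regularity of the primitive `μ`-reading `m = μ(2^s L₂) mod ω_7`: `m = 1 + boundaryG` for all HEAD, `N = 9q`,
E5OTHER rows and E1169/E2535; `m = 2` with `boundaryG = 0` for the 19 «both» curves ≠ 17a1; `m = 4` for 15a1–a8, 17a1, 17a2.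
This upgrades barrier note E5 (`no-local-law-lambda2`) from ENGINE grade to TWO-ENGINE-EXACT for every member.
(2) `boundaryG` (rigorous generator test; A via `mspolygon`, B via `Gamma0(N).gens()`, agreeing on all 70):
`= 1`: HEAD 65a1, 1585a1, 4033a1, 7985a1; all twelve `N = 9q` curves 603a1/b1, 1251a1/b1, 1899a1/b1, 2763a1/b1,
5139a1/b1, 6651a1/b1 (rank 0, `Λ(0) = ±2`); E5OTHER 185c1, 3785b1, 4553a1, 5993a1, 9865a1; controls 15a1–a8,
17a1, 17a2, E2535.  `= 0`: HEAD 145a1, 689a1, 1745a1, 5105a1, 9089a1; all 20 «both» curves except 17a1; E5OTHER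
725a1, 8725a1, 8957a1, 505a1, 793a1, 905a1, 3545a1, 7289a1, 8345a1, 205b1, 2845a1, 5069b1, 9077a1; E1169.
(3) Level-one Kurihara numbers, production r2 j314211 (engine A: singles `ℓ ≤ 1500`, pairs `ℓᵢ ≤ 220`, triples
`ℓᵢ ≤ 53 ∧ n ≤ 5·10⁴`, quads `ℓᵢ ≤ 29 ∧ n ≤ 4·10⁴`; engine B: singles `ℓ ≤ 300`, pairs `ℓᵢ ≤ 120`; 24561 values computed
by BOTH engines, 0 parity mismatches; all in-run control identities hold on all 70 curves; engine A's lists in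
j313310–j314084 were EMPTY by a shadowed-variable bug — those "none to bound" verdicts are withdrawn, r2 replaces them):
 • every `boundaryG = 1 ∧ Λ(0) even` curve (HEAD 65a1, 1585a1, 4033a1, 7985a1; the twelve `N = 9q`; 185c1, 3785b1,
   4553a1, 5993a1, 9865a1; E2535): NO odd number in the whole range — as F6 proves for every `n`;
 • `boundaryG = 1 ∧ Λ(0) odd` (15a1–a8, 17a1, 17a2): unit at `n = 1`, and ALL type-(3,3) pairs odd (276/276, 300/300),
   exactly the class-function prediction `u(ℓ₁ℓ₂) ≡ ((ℓ₁−1)/2)((ℓ₂−1)/2)`;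
 • `boundaryG = 0`: UNIT WITNESS FOUND for 33 of 37 curves, first odd pair at `n ∈ {21, 33, 57, 69, 77, 93, 133}`
   (HEAD: 145a1 `u(21) = −1`, 689a1 `u(57) = −1`, 1745a1 `u(21) = −1`, 5105a1 `u(21) = −1`, 9089a1 `u(33) = −1`;
   25–35 % of type-(3,3) pairs odd), only type (3,3) pairs are ever odd (types (1,1), (1,3): 0 odd of > 30000);
 • SECOND OBSTRUCTION STRATUM (empirical, NOT detected by the boundary test): `boundaryG = 0` and NO witness in the whole
   range for 725a1, 8725a1, 8957a1 (rank 1) and the control E1169 (rank 0, `Λ(0) = −2`, no rational 2-torsion).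
   The three rank-1 exceptions are exactly the quadratic twists of HEAD curves by the REAL character of their
   multiplicative prime `q ≡ 1 (mod 4)`: `725a1 = 145a1 ⊗ χ₅`, `8725a1 = 1745a1 ⊗ χ₅`, `8957a1 = 689a1 ⊗ χ₁₃`
   (`a_ℓ(E') = χ_q(ℓ) a_ℓ(E)` checked on 236 primes each), and for them `v₂ B(ℓ) ∈ {3,5,7,9}` (odd, ≥ 3) at every
   `ℓ ≡ 1 (4)` versus `{2,4,6,8}` for the untwisted curve (`B(ℓ) = Σ_a (a/ℓ) Λ(a/ℓ)`): one extra 2 in every twisted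
   special value relative to the value lattice, killing the type-(3,3) mechanism (`u = B_{ℓ₁ℓ₂}/4` in rank 1).
   Heuristic (Birch's lemma, not proved here): `Λ_{E⊗χ_q} ≡ u·(Λ_E∘[q] + Λ_E) (mod 2)`, under which every type-(3,3)
   pair sum is provably even; the triple/quad evenness is data only.  So "restrict to `boundaryG = 0`" does NOT
   repair `UnitKuriharaSupplyAtTwo`; the E5 head class itself splits 4 (bdG = 1, no witness ever) : 5 (tiny witnesses).
(4) Twists for card (c) (engine A, exact minus-symbol twist formula, checked against direct `msfromell` of the twist on
(15a1, −7), (17a1, −15): ratio 1; `λ(L₂(E^{(d)}))` stable at `n = 5, 6, 7`; all `d ≡ 1 (mod 8)`, Heegner for `N`):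
15a1/15a3/15a8: d = −71 → 4; 15a1: −7 → 4; 17a1: −47 → 10, −15 → 6; 73a1: −23 → 6; 65a1: −79 → 8 (`rk_an(E^d) = 2`);
145a1: −71 → 4 (`rk_an(E^d) = 0`); 603a1: −95 → 7; 603b1: −95 → 5; E1169: −55 → 6.  These are the elliptic-side inputs
`λ(E/K_∞^{cyc}) = λ(E) + λ(E^{(d)})` (2 split in `K = ℚ(√d)`) the card's determinant comparison would need; the
anticyclotomic / Katz side at `p = 2` has no construction in print for non-CM `E` (presearch in NOTES), so falsifier (c)
stops at inputs: no kill, no support.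
(5) PARI's `mspadicseries` is a Taylor series in `s`; its conversion to `T` loses precision — dropped as a reading.
(6) FIRST-RUNG smoke j320785 (cdisprove-g1; engines L, A-lite; `n ≤ 1`; MANIFEST.sha256 in the job outputs).  Engine L, `|E(F_n)[2]|, |E(F_n)[2^∞]|`
at `n = 0, 1` (`F_0 = ℚ₂`, `F_1 = ℚ₂(√2)`), all root counts Hensel-certified, square classes exact: 15a1 (4, 8), (4, 8); 17a1 (2, 4), (2, 4);
65a1 (4, 8), (4, 8); 73a1 (2, 2), (2, 2); 145a1 (4, 8), (4, 8); 603b1 (4, 4), (4, 4) — no growth from `n = 0` to `1`; every curve has exactly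
one 2-torsion `x`-root in the formal group (`v₂(x) < 0`), as theory demands (`a₂` odd).  Engine A-lite (levels 4, 5, stable):
`λ(L₂E)` = 15a1 0, 17a1 0, 65a1 2, 73a1 0, 145a1 4, 603b1 3 (= j314211); twists `λ(L₂E^{(−D)})`: 145a1/71 → 4, 15a1/71 → 4, 17a1/15 → 6,
603b1/95 → 5, 65a1/79 → 8 (`rk_an = 2`), 73a1/71 → 6, 73a1/79 → 10, 73a1/23 → 6 (all = DATA (4) where present; 73a1/71, 73a1/79 new).
Engine R: class numbers `h(K_0), h(K_1)` = D=7: 1, 2 (`Cl₂`-ranks 0, 1); D=71: 7, 14 (0, 1), certified; the `d(T,U)` menu died on the lexer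
bug (fixed) — the GL(1) rows proper await THE batched run.

## F10 — RESULTS of THE batched FIRST-RUNG GL(1) table (kit j321331; director-bsd ruling (314)(4); pen RC-351 (3) / RC-360 (A2)) — DATA (7)
ROWS: 80 admissible pairs `(E, K = ℚ(√−D))` (30 curves × `D ∈ {7,15,23,31,39,47,55,71,79,95}`), layers `n ≤ 3` (`n ≤ 4` for
`D ∈ {7,15,23,31,71}`); `d_S` := BDP menu `d(S ∪ {w̄}, {w})` at `n_max`, STABILISED (equal at `n_max − 1`) on 70 rows; engine Q =
conv-1 GEN 28's `gl1lambda2.gp` functions verbatim (its j321042 rows reproduced: (71,{3,5}) → 4, (79,{5,13}) → 6, (71,{5,29}) → 4).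
CONTROLS (all pass): SYM = BDP on every (pair, n) (complex conjugation); CL = `rk₂ bnf.cyc` on all 45 fields; `λ(L₂E)` = j314211 on
30/30; MSD readings stable on 110/110; ERR 0.  GRH assumed above degree 4.  EVIDENCE tier; BSD is not proved by any of this.
(a) GL(1) ANALYTIC = ALGEBRAIC: `d_S(n_max) = Q_an(D,S) := λ(g⁺_S) + λ(ζ_S-part)` on ALL 70 stabilised rows (and `d_S ≤ Q_an`, still
    growing, on the 10 unstabilised ones: 1153a1 ×4 needs `n ≥ 5` since `s_1153(ℚ_∞) = 32`; 17a1/47, 113a1/31, 353a1/39, 353a1/47,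
    593b1/31, 593b1/79).  This is the cyc-line GL(1) main conjecture at 2 over `K` in `𝔽₂`-count form, row by row (`𝔛 = Gal(𝔐_S/K_∞)`
    `ℤ₂`-free there): POSITIVE numerical evidence for the line's GL(1) inputs (B3b/B3c) and for conv-1's D2 carriers (p679922/p680491/p680767).
(b) GENUS LAW: `d_S = Q_∅(D) + Σ_{v∈S} δ_v` on 61/70 stabilised rows, `Q_∅(D)` = the field-only (`S = ∅`) value (`0` for
    `D = 7,15,23,39,55,71,95`; `2` for `47, 79`; `6` for `31`) and `Σδ_v = Σ_{ℓ ∥ N} 2·s_ℓ(ℚ_∞)`, `s_ℓ(ℚ_∞) = 2^{max(v₂(ℓ²−1)−3,0)}`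
    [Matsuno 2008 IJNT 4(3) Cor 2.3 + Lemma 2.4, pp. 406–407: `ε⁺_v = ε⁻_v = 1` at `p = 2`]; the 9 exceptions are exactly the rows with an
    ADDITIVE prime (603a1/b1, 1251a1/b1, 1899a1/b1 at 3; 725a1 at 5): there `d_S = Q_∅(D) + Σδ_v + 2`.
(c) TWIST LAW (Kida at `p = 2`): `λ(L₂E^K) = 2·Σ_{q∣D} s_q(ℚ_∞) + c(E)` with `c(E) = 2` on the eleven rank-0 prime-conductor «both»
    curves and E1169, `c(E) = 0` on the ten rank-1 curves (HEAD, E5OTHER rank 1) and on 15a1, `c ∈ {1,3,7}` on the additive-prime curves —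
    INDEPENDENT of `λ(L₂E)` (689a1: `λ(E) = 14`, `λ(E^K) = 4`; 593b1: `4`, `6`).  Print: Matsuno 2008 Thm 3.1 (Kida's formula for 2-extensions,
    (a) ⇔ (b) with (H1)) and §§4–5 (quadratic twists at `p = 2`); the absence of an additive `λ(E)` term says `X(E/K^{cyc}_∞)` is NOT
    finitely generated over `ℤ₂` on those rows ((H1) fails when `Δ_E > 0`, `K` imaginary) — consistent with `μ_read(L₂E^K) = 1` on 80/80.
(d) CONSEQUENCE FOR RC-360 (A2): `Δ(E,K) := 2d_S − Σδ_v − (λ(L₂E) + λ(L₂E^K) − g) = 2Q_∅(D) + Σδ_v [+4 additive] − λ(L₂E) −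
    2Σ_{q∣D}s_q − c(E) + g` is a PRIME-SPLITTING BOOKKEEPING quantity with no BDP-side content.  Histogram on the 70 stabilised rows:
    `−2` ×49, `−6` ×8, `0` ×4, `−4` ×3, `+2` ×2, `+8` ×2, `−8` ×1, `−12` ×1; 58 rows meet (A2)'s «firm negative» criterion, INCLUDING every
    control pair (73a1, 89b1, 233a1, 1289a1, 1433a1, 1913b1 × all their `D`; 15a1/71 and E1169/55 give `0`).  Since stub 6″ ⟺ `λ`-IMC(E) ∧
    `λ`-IMC(E^K) (kernel `gD_le_lambda_iff_eq_and_eq`, F9), reading these rows as kills of «(B3a-exact) ∧ 6″» would refute the 2-adic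
    `λ`-main conjecture for 73a1, 89b1, … — absurd.  VERDICT: the (A2) band `0 ≤ Δ ≤ d_S + 1 + 𝟙₈ + τ^S` / kill criterion is UNSOUND as a
    test (planning-level refutation of Δ17-5's normalisation as adopted in RC-360 (A)); the FIRST-RUNG table cannot test 6″ (confirms F8:
    `λ(X_Gr) = gD` is the BDP/`F⁺`-side invariant, the table sees only the ordinary side through Kida + genus theory).  What the table DOES
    pin for any typed (B3a-exact): `λ(X_Gr) + (r + u_w + τ^S) = 2d_S − Σδ_v = λ(L₂E) + λ(L₂E^K) − g + Δ(E,K)` with the measured `Δ` of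
    DATA (7); under `hPT` + IMC (`λ(X_Gr) = gD = λ⁺ + g`) this is a row-by-row PREDICTION for the Kato determinant's `F⁺`-coordinate,
    `λ⁺ = λ(L₂E) + λ(L₂E^K) − 2g + Δ − (r + u_w + τ^S)`, e.g. `λ⁺ = 4 − (r + u_w + τ^S)` on 73a1/ℚ(√−23) — to be confronted with the
    genuine Shapiro datum once 4″'s `S` is built; no stub of v4.3 is killed by the table.
(e) No stub-false evidence results: 6″ = crux pair (unchanged), 4″ untouched by GL(1) data; the D3 deliverable (B3a-exact + band) must be
    RE-NORMALISED against DATA (7) before v5 types a `Q_an`/B3a clause (learning for the proof side).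

## HANDOFF
Landed under `Negative/`: `UnitKuriharaWitnessLevelOne.lean` (p651356), `UnitKuriharaWitnessEvenValues.lean` (p653405),
`PinnedSupplyMuDefect.lean` (p680224: `muInvariant_le_of_injective`, `muInvariant_quot_le_of_pinnedKatoGreenbergDatum`,
`isEmpty_pinnedKatoGreenbergDatum_of_muInvariant_lt`, `pinnedKatoGreenbergSupplyAtTwo_false_of_muDefect`; §4 appended p680711:
`muInvariant_quotL_le_of_shapiroKatoGreenbergDatum`, `isEmpty_shapiroKatoGreenbergDatum_of_forall_muInvariant_lt` for the v4.3 datum).  Sorried here: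
`unitKuriharaSupplyAtTwo_false` only (in-tree evaluation of `ratPlusSymbol` for `65a1` missing; typed version
`unitKuriharaSupplyAtTwo_false_of_data` is sorry-free).  Kit: j313728/j313889/j313929 (smokes), j314084 (production; engine-A Kurihara
lists void), j314211 (production r2, authoritative), j320785 (FIRST-RUNG smoke: engines L/A-lite validated, engine R lexer bug found);
THE FIRST-RUNG batched run = j321331 (done; F10 / DATA (7): GL(1) analytic = algebraic on 70/70 stabilised rows; genus law; Kida twist law; RC-360 (A2)'s Δ-band unsound; no stub killed).  Targets (line
`kato_determinant_greenberg_two` v4.2 → v4.3): 4″/6″ of v4.3 = repair R1, re-audited in F7 (e) (typed `μ`-obligation, no junk `L`, no cheap kill); 4′ stub-misstated (empty on `{Δ_W < 0}`, kernel p680224 + print Δ16-1; repair R1/R2); 6′ =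
crux-pair in `λ`-currency (unkillable short of the crux; vacuous where 4′ is empty); `stub_pub`, `stub_irreducibleResidual`,
`stub_residualGL1PrintFactsAtTwo` are print-intake binders (nothing to kill cheaply; GL1 print facts get their numeric shadow from the
FIRST-RUNG table).  Next regimes: (i) DONE — table j321331 posted (F10); follow-up only if the pen re-normalises (B3a-exact): re-run `post.py` on `~/compute/j321331/outputs` with the new constant (no new kit needed);
(ii) after the lead's R1/R2 reshape, re-audit the new binder for a `μ`/saturation leak on the `{Δ_W > 0}` half (`t₂`-torsion of the
Shapiro cokernel, Δ17-1: `λ`-visible? if `C_tors` has `λ > 0` the repaired identity needs its `c`); (iii) the second stratum of F6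
(`Λ_{E⊗χ_q}` parity transfer) remains open from g0; (iv) the crux `OrdLambdaHalfAtTwo` itself stays open, un-killed (F0).
-/

set_option linter.dupNamespace false
set_option autoImplicit false

noncomputable section

open scoped Classical MatrixGroups ModularForm
open CongruenceSubgroup WeierstrassCurve Literature.NumberTheory.EllipticCurves
  Literature.NumberTheory.EllipticCurves.ModularForms Literature.NumberTheory.EllipticCurves.Rank1Residual
  Summit.BirchSwinnertonDyer.BirchSwinnertonDyer.Theorems.TwoAdicTwistConverse
open Literature.NumberTheory.DiophantineGeometry.Dioph (ratModP)
open Summit.BirchSwinnertonDyer.Rank1Residual.Supersingular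
open Summit.BirchSwinnertonDyer.BirchSwinnertonDyer.Theorems.OrdLambdaHalfAtTwo.Negative

namespace Summit.BirchSwinnertonDyer.BirchSwinnertonDyer.Cruxes.OrdLambdaHalfAtTwo.Disproof

/-! ## Verbatim copies of the sketch's objects
The Lean farm does not build `Cruxes/…` modules for import (check answers `rc 75 unbuilt:…TwoPowerSlackRigidityTwoSketch`),
so the three objects of `TwoPowerSlackRigidityTwoSketch.lean` attacked here are restated VERBATIM (same bodies); every
result below transfers to the sketch's names by `rfl` / `Iff.rfl` in any file that can import both. -/

/-- VERBATIM copy of `…Cruxes.OrdLambdaHalfAtTwo.TwoPowerSlackRigidityTwo.kuriharaNumberScaled` (the `c`-scaled Kurihara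
number at `2`, `δ^{(c)}_n ∈ ℤ/2^k`). -/
def kuriharaNumberScaled {N : ℕ} (f : CuspForm (Gamma0 N) 2) (c : ℚ) (k n : ℕ) [NeZero n]
    (ψ : (ℓ : ℕ) → (ZMod ℓ)ˣ →* Multiplicative (ZMod (2 ^ k))) : ZMod (2 ^ k) :=
  ∑ a : (ZMod n)ˣ, ratModP (2 ^ k) (c * ratPlusSymbol f (((a : ZMod n).val : ℚ) / n)) *
    ∏ ℓ ∈ n.primeFactors.attach,
      Multiplicative.toAdd (ψ ℓ.1 (ZMod.unitsMap (Nat.dvd_of_mem_primeFactors ℓ.2) a))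

/-- VERBATIM copy of `…TwoPowerSlackRigidityTwo.UnitKuriharaWitnessAtTwo`. -/
def UnitKuriharaWitnessAtTwo (W : WeierstrassCurve ℚ) [W.IsElliptic] [W.IsGloballyMinimal]
    {N : ℕ} (f : CuspForm (Gamma0 N) 2) : Prop :=
  ∃ (c : ℚ) (k n : ℕ) (_ : NeZero n) (ψ : (ℓ : ℕ) → (ZMod ℓ)ˣ →* Multiplicative (ZMod (2 ^ k))),
    c ≠ 0 ∧ (∀ r : ℚ, ‖((c * ratPlusSymbol f r : ℚ) : ℚ_[2])‖ ≤ 1) ∧ 1 ≤ k ∧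
    Kato.IsKolyvaginProduct W 2 k n ∧ (∀ ℓ ∈ n.primeFactors, Function.Surjective (ψ ℓ)) ∧
    IsUnit (kuriharaNumberScaled f c k n ψ)

/-- VERBATIM copy of `…TwoPowerSlackRigidityTwo.UnitKuriharaSupplyAtTwo` (the line's SUPPLY statement). -/
def UnitKuriharaSupplyAtTwo : Prop :=
  ∀ (W : WeierstrassCurve ℚ) [W.IsElliptic] [W.IsGloballyMinimal], ¬ W.HasCM → GoodOrd W 2 →
    ∀ [NeZero (W.conductorNorm ℤ)] (f : CuspForm (Gamma0 (W.conductorNorm ℤ)) 2), IsNewformOf W f →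
      UnitKuriharaWitnessAtTwo W f

/-! ## F1 — load-bearing hypotheses, typed -/

/-- The crux with the hypothesis `IsNewformOf W f` DROPPED (`f` any cusp form of level `N_W`).  False at `f = 0`
whenever the prefix `(W, κ, γ, D)` is inhabited (`L₂(0, α) = 0` forces `L₀ = 0`); not refuted in-tree because
`Nonempty (W.SelmerDualData κ γ)` is not constructible here.  Typed record only. -/
def OrdLambdaHalfAtTwoWithoutNewform : Prop :=
  ∀ (W : WeierstrassCurve ℚ) [W.IsElliptic] [W.IsGloballyMinimal], ¬ W.HasCM → GoodOrd W 2 →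
    ∀ (κ : ZpExtension ℚ 2) (γ : Field.absoluteGaloisGroup ℚ),
      κ.IsCyclotomic → κ.IsTopGenerator γ → IsCyclotomicVariable 2 γ → IsOrdinaryAt W 2 →
    ∀ [NeZero (W.conductorNorm ℤ)] (f : CuspForm (Gamma0 (W.conductorNorm ℤ)) 2),
    ∀ (D : W.SelmerDualData κ γ), ∃ (c : ℚ) (L₀ : IwasawaAlgebra 2), L₀ ≠ 0 ∧
      iwasawaToPowerSeries 2 L₀ = PowerSeries.C (c : ℚ_[2]) * padicLFunction f (unitRoot W 2 : ℚ_[2]) ∧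
      Summit.BirchSwinnertonDyer.Rank1Residual.X1.MuLambda.lam L₀ ≤ D.lambda

/-- The crux with `¬ W.HasCM` DROPPED.  No cheap separating model (a CM curve ordinary at `2` would need its
2-adic `L` in-tree); plausibly still true (Kato/Rubin divisibilities exist for CM forms as well). Typed record. -/
def OrdLambdaHalfAtTwoWithCM : Prop :=
  ∀ (W : WeierstrassCurve ℚ) [W.IsElliptic] [W.IsGloballyMinimal], GoodOrd W 2 →
    ∀ (κ : ZpExtension ℚ 2) (γ : Field.absoluteGaloisGroup ℚ),
      κ.IsCyclotomic → κ.IsTopGenerator γ → IsCyclotomicVariable 2 γ → IsOrdinaryAt W 2 →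
    ∀ [NeZero (W.conductorNorm ℤ)] (f : CuspForm (Gamma0 (W.conductorNorm ℤ)) 2), IsNewformOf W f →
    ∀ (D : W.SelmerDualData κ γ), ∃ (c : ℚ) (L₀ : IwasawaAlgebra 2), L₀ ≠ 0 ∧
      iwasawaToPowerSeries 2 L₀ = PowerSeries.C (c : ℚ_[2]) * padicLFunction f (unitRoot W 2 : ℚ_[2]) ∧
      Summit.BirchSwinnertonDyer.Rank1Residual.X1.MuLambda.lam L₀ ≤ D.lambda

/-- Sanity: the crux is the `¬ HasCM`-restriction of `OrdLambdaHalfAtTwoWithCM` (pure logic). -/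
theorem ordLambdaHalfAtTwo_of_withCM (h : OrdLambdaHalfAtTwoWithCM) :
    Summit.BirchSwinnertonDyer.BirchSwinnertonDyer.Theses.TwoAdicConverse.OrdLambdaHalfAtTwo := by
  show Summit.BirchSwinnertonDyer.BirchSwinnertonDyer.Theorems.TwoAdicTwistConverse.OrdLambdaHalfAtTwo
  intro W _ _ _ hgo
  exact h W hgo

/-- Sanity: `OrdLambdaHalfAtTwoWithoutNewform` implies the crux (pure logic). -/
theorem ordLambdaHalfAtTwo_of_withoutNewform (h : OrdLambdaHalfAtTwoWithoutNewform) :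
    Summit.BirchSwinnertonDyer.BirchSwinnertonDyer.Theses.TwoAdicConverse.OrdLambdaHalfAtTwo := by
  show Summit.BirchSwinnertonDyer.BirchSwinnertonDyer.Theorems.TwoAdicTwistConverse.OrdLambdaHalfAtTwo
  intro W _ _ hcm hgo κ γ h1 h2 h3 h4 _ f _ D
  exact h W hcm hgo κ γ h1 h2 h3 h4 f D

/-! ## F2 — the supply statement of `two-power-slack-rigidity-two` is a level-one parity statement -/

/-- Restatement of the landed lemma for the sketch's name: at level `k ≥ 1`, `n > 2` with all prime factors
`≡ 1 (mod 4)`, `kuriharaNumberScaled f c k n ψ` is not a unit. -/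
theorem kuriharaNumberScaled_not_isUnit {N : ℕ} [NeZero N] (f : CuspForm (Gamma0 N) 2) (c : ℚ)
    {k n : ℕ} [NeZero n] (hk : 1 ≤ k) (hn : 2 < n) (h4 : ∀ ℓ ∈ n.primeFactors, ℓ % 4 = 1)
    (ψ : (ℓ : ℕ) → (ZMod ℓ)ˣ →* Multiplicative (ZMod (2 ^ k))) :
    ¬ IsUnit (kuriharaNumberScaled f c k n ψ) :=
  not_isUnit_sum_ratModP_mul_prod_toAdd f c hk hn h4 ψ

/-- At level `k ≥ 2`: a unit `kuriharaNumberScaled` for a Kolyvagin product `n` forces `n = 1`. -/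
theorem kuriharaNumberScaled_not_isUnit_of_two_le (W : WeierstrassCurve ℚ) [W.IsGloballyMinimal]
    {N : ℕ} [NeZero N] (f : CuspForm (Gamma0 N) 2) (c : ℚ) {k n : ℕ} [NeZero n] (hk : 2 ≤ k)
    (hprod : Kato.IsKolyvaginProduct W 2 k n) (hn1 : n ≠ 1)
    (ψ : (ℓ : ℕ) → (ZMod ℓ)ˣ →* Multiplicative (ZMod (2 ^ k))) :
    ¬ IsUnit (kuriharaNumberScaled f c k n ψ) := by
  obtain ⟨hn2, h4⟩ := two_lt_and_mod_four_of_isKolyvaginProduct W hk hprod hn1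
  exact kuriharaNumberScaled_not_isUnit f c (by omega) hn2 h4 ψ

/-- **F3 — natural strengthening refuted**: no unit scaled Kurihara number at `2` of level `k ≥ 2` off `n = 1`. -/
theorem not_exists_unit_witness_of_two_le :
    ¬ ∃ (W : WeierstrassCurve ℚ) (_ : W.IsGloballyMinimal) (N : ℕ) (_ : NeZero N) (f : CuspForm (Gamma0 N) 2)
        (c : ℚ) (k n : ℕ) (_ : NeZero n) (ψ : (ℓ : ℕ) → (ZMod ℓ)ˣ →* Multiplicative (ZMod (2 ^ k))),
        2 ≤ k ∧ n ≠ 1 ∧ Kato.IsKolyvaginProduct W 2 k n ∧ IsUnit (kuriharaNumberScaled f c k n ψ) := by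
  rintro ⟨W, _, N, _, f, c, k, n, _, ψ, hk, hn1, hprod, hu⟩
  exact kuriharaNumberScaled_not_isUnit_of_two_le W f c hk hprod hn1 ψ hu

/-- `2`-integrality of `c·[r]⁺` (the witness's hypothesis) gives odd denominators. -/
theorem not_two_dvd_den_of_witness {N : ℕ} (f : CuspForm (Gamma0 N) 2) {c : ℚ}
    (hc : ∀ r : ℚ, ‖((c * ratPlusSymbol f r : ℚ) : ℚ_[2])‖ ≤ 1) (r : ℚ) :
    ¬ 2 ∣ (c * ratPlusSymbol f r).den :=
  not_dvd_den_of_norm_ratCast_le_one (hc r)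

/-- Reduction `ℤ/2^k → ℤ/2^j` (`j ≤ k`) commutes with `ratModP` on `2`-integral rationals. -/
theorem castHom_ratModP_pow {k j : ℕ} (hjk : j ≤ k) {q : ℚ} (hq : ¬ 2 ∣ q.den) :
    ZMod.castHom (pow_dvd_pow 2 hjk) (ZMod (2 ^ j)) (ratModP (2 ^ k) q) = ratModP (2 ^ j) q := by
  rw [ratModP_eq_toZModPow 2 k hq, ratModP_eq_toZModPow 2 j hq]
  exact RingHom.congr_fun (PadicInt.zmod_cast_comp_toZModPow j k hjk) _

/-- The discrete logarithms reduced from level `k` to level `j`. -/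
def reduceLog {k j : ℕ} (hjk : j ≤ k) (ψ : (ℓ : ℕ) → (ZMod ℓ)ˣ →* Multiplicative (ZMod (2 ^ k))) :
    (ℓ : ℕ) → (ZMod ℓ)ˣ →* Multiplicative (ZMod (2 ^ j)) :=
  fun ℓ => (AddMonoidHom.toMultiplicative
    (ZMod.castHom (pow_dvd_pow 2 hjk) (ZMod (2 ^ j))).toAddMonoidHom).comp (ψ ℓ)

theorem reduceLog_surjective {k j : ℕ} (hjk : j ≤ k)
    (ψ : (ℓ : ℕ) → (ZMod ℓ)ˣ →* Multiplicative (ZMod (2 ^ k))) {ℓ : ℕ}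
    (hψ : Function.Surjective (ψ ℓ)) : Function.Surjective (reduceLog hjk ψ ℓ) := by
  intro y
  obtain ⟨x, hx⟩ := ZMod.castHom_surjective (pow_dvd_pow 2 hjk) (Multiplicative.toAdd y)
  obtain ⟨u, hu⟩ := hψ (Multiplicative.ofAdd x)
  refine ⟨u, ?_⟩
  change Multiplicative.ofAdd (ZMod.castHom (pow_dvd_pow 2 hjk) (ZMod (2 ^ j))
    (Multiplicative.toAdd (ψ ℓ u))) = y
  rw [hu]
  change Multiplicative.ofAdd (ZMod.castHom (pow_dvd_pow 2 hjk) (ZMod (2 ^ j)) x) = y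
  rw [hx]
  rfl

/-- **Level lowering.** Under the witness's `2`-integrality, the level-`j` scaled Kurihara number with the
reduced logarithms is the reduction of the level-`k` one. -/
theorem castHom_kuriharaNumberScaled {N : ℕ} (f : CuspForm (Gamma0 N) 2) {c : ℚ}
    (hc : ∀ r : ℚ, ‖((c * ratPlusSymbol f r : ℚ) : ℚ_[2])‖ ≤ 1) {k j : ℕ} (hjk : j ≤ k) (n : ℕ) [NeZero n]
    (ψ : (ℓ : ℕ) → (ZMod ℓ)ˣ →* Multiplicative (ZMod (2 ^ k))) :
    ZMod.castHom (pow_dvd_pow 2 hjk) (ZMod (2 ^ j)) (kuriharaNumberScaled f c k n ψ) =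
      kuriharaNumberScaled f c j n (reduceLog hjk ψ) := by
  unfold kuriharaNumberScaled
  rw [map_sum]
  refine Finset.sum_congr rfl fun a _ => ?_
  rw [map_mul, map_prod, castHom_ratModP_pow hjk (not_two_dvd_den_of_witness f hc _)]
  rfl

/-- A LEVEL-ONE unit Kurihara witness at `2` (the `k = 1` case of `UnitKuriharaWitnessAtTwo`). -/
def LevelOneUnitWitness (W : WeierstrassCurve ℚ) [W.IsElliptic] [W.IsGloballyMinimal]
    {N : ℕ} (f : CuspForm (Gamma0 N) 2) : Prop :=
  ∃ (c : ℚ) (n : ℕ) (_ : NeZero n) (ψ : (ℓ : ℕ) → (ZMod ℓ)ˣ →* Multiplicative (ZMod (2 ^ 1))),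
    c ≠ 0 ∧ (∀ r : ℚ, ‖((c * ratPlusSymbol f r : ℚ) : ℚ_[2])‖ ≤ 1) ∧
    Kato.IsKolyvaginProduct W 2 1 n ∧ (∀ ℓ ∈ n.primeFactors, Function.Surjective (ψ ℓ)) ∧
    IsUnit (kuriharaNumberScaled f c 1 n ψ)

/-- **REDUCTION (F2).** The supply statement's witness predicate is equivalent to its level-one case:
`UnitKuriharaWitnessAtTwo W f ↔ LevelOneUnitWitness W f` (reduce mod `2`: units stay units, Kolyvagin products of
level `k` are of level `1`, surjective logs stay surjective).  The "2-power slack" supply has no 2-adic depth. -/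
theorem unitKuriharaWitnessAtTwo_iff_levelOne (W : WeierstrassCurve ℚ) [W.IsElliptic] [W.IsGloballyMinimal]
    {N : ℕ} (f : CuspForm (Gamma0 N) 2) : UnitKuriharaWitnessAtTwo W f ↔ LevelOneUnitWitness W f := by
  constructor
  · rintro ⟨c, k, n, hn, ψ, hc0, hc, hk, hprod, hsurj, hu⟩
    refine ⟨c, n, hn, reduceLog hk ψ, hc0, hc, hprod.mono hk, fun ℓ hℓ => reduceLog_surjective hk ψ (hsurj ℓ hℓ),
      ?_⟩
    rw [← castHom_kuriharaNumberScaled f hc hk n ψ]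
    exact hu.map _
  · rintro ⟨c, n, hn, ψ, hc0, hc, hprod, hsurj, hu⟩
    exact ⟨c, 1, n, hn, ψ, hc0, hc, le_rfl, hprod, hsurj, hu⟩

/-- **Shape of a level-one witness.** If `n ≠ 1` then `n > 2` and some prime factor of `n` is `≡ 3 (mod 4)`
(all Kolyvagin primes at `2` are odd; if all were `≡ 1 (mod 4)` the number would not be a unit). -/
theorem levelOne_witness_shape (W : WeierstrassCurve ℚ) [W.IsGloballyMinimal]
    {N : ℕ} [NeZero N] (f : CuspForm (Gamma0 N) 2) (c : ℚ) {n : ℕ} [NeZero n]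
    (ψ : (ℓ : ℕ) → (ZMod ℓ)ˣ →* Multiplicative (ZMod (2 ^ 1)))
    (hprod : Kato.IsKolyvaginProduct W 2 1 n) (hn1 : n ≠ 1) (hu : IsUnit (kuriharaNumberScaled f c 1 n ψ)) :
    2 < n ∧ ∃ ℓ ∈ n.primeFactors, ℓ % 4 = 3 := by
  have hodd : ∀ ℓ ∈ n.primeFactors, ℓ % 2 = 1 := fun ℓ hℓ => by
    have h := (hprod.2 ℓ hℓ).2.2.1
    simpa [Nat.ModEq] using h
  have hn0 : n ≠ 0 := hprod.ne_zero
  have hn2 : n ≠ 2 := fun h2 => by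
    subst h2
    have := hodd 2 (Nat.mem_primeFactors.mpr ⟨Nat.prime_two, dvd_rfl, two_ne_zero⟩)
    omega
  have hn : 2 < n := by omega
  refine ⟨hn, ?_⟩
  obtain ⟨ℓ, hℓ, hℓ4⟩ := exists_primeFactor_mod_four_ne_one_of_isUnit f c ψ le_rfl hn hu
  exact ⟨ℓ, hℓ, by have := hodd ℓ hℓ; omega⟩

/-! ## F4 — typed statement of what the falsifier job excludes (rows: DATA (3), kit j314211) -/

/-- No level-one unit Kurihara witness at `2` for `(W, f)` with `n` in the set `S`.  The batched job decides this
(for the primitive scaling `c = 1/q₀`, `q₀ℤ = ℤ⟨[r]⁺_f⟩`, and the quadratic-residue logarithms — WLOG at level one)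
for explicit finite `S` per curve; rows `-- DATA` below. -/
def NoLevelOneUnitWitnessOn (W : WeierstrassCurve ℚ) [W.IsElliptic] [W.IsGloballyMinimal]
    {N : ℕ} (f : CuspForm (Gamma0 N) 2) (S : Set ℕ) : Prop :=
  ¬ ∃ (c : ℚ) (n : ℕ) (_ : NeZero n) (ψ : (ℓ : ℕ) → (ZMod ℓ)ˣ →* Multiplicative (ZMod (2 ^ 1))),
    n ∈ S ∧ c ≠ 0 ∧ (∀ r : ℚ, ‖((c * ratPlusSymbol f r : ℚ) : ℚ_[2])‖ ≤ 1) ∧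
    Kato.IsKolyvaginProduct W 2 1 n ∧ (∀ ℓ ∈ n.primeFactors, Function.Surjective (ψ ℓ)) ∧
    IsUnit (kuriharaNumberScaled f c 1 n ψ)

/-- Pure logic: excluding every `n` excludes the witness (so a per-curve boundary certificate, which covers
`S = Set.univ`, is a per-curve `¬ UnitKuriharaWitnessAtTwo`, i.e. a counterexample to `UnitKuriharaSupplyAtTwo`
once `(W, f)` satisfy its hypotheses). -/
theorem not_unitKuriharaWitnessAtTwo_of_univ (W : WeierstrassCurve ℚ) [W.IsElliptic] [W.IsGloballyMinimal]
    {N : ℕ} (f : CuspForm (Gamma0 N) 2) (h : NoLevelOneUnitWitnessOn W f Set.univ) :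
    ¬ UnitKuriharaWitnessAtTwo W f := by
  rw [unitKuriharaWitnessAtTwo_iff_levelOne]
  rintro ⟨c, n, hn, ψ, hc0, hc, hprod, hsurj, hu⟩
  exact h ⟨c, n, hn, ψ, Set.mem_univ _, hc0, hc, hprod, hsurj, hu⟩

-- DATA (pending): per-curve rows `label | q₀ | boundary_mod2 | [0]⁺ parity | first odd u(n) or none to bound | job`.

-- Targets: none served yet (no line picked; payload carries no `line`/`targets`).

/- DATA (7) — kit j321331 (THE batched FIRST-RUNG GL(1) table; director-bsd g16 ruling (314)(4); pen RC-351 (3) / RC-360 (A2)).  EVIDENCE tier;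
   GRH-conditional class groups above degree 4 (bnfcertify at degree <= 4); BSD is not proved by any of this.
   Column Delta(E,K) := 2 d_S - Sum_{v in S} delta_v - (lambda(L_2 E) + lambda(L_2 E^K) - g)  [RC-360 (A2); prediction of (B3a-exact, Delta17-5): 0 <= Delta <= d_S + 1 + 1_8 + tau^S;
   a NEGATIVE row with stabilised d_S and certified g is the pen's kill criterion for (B3a-exact) /\ stub 6'' on that row].
   rows: 80 complete; NEGATIVE: 69 (firm: 58); GL(1)-IMC control anomalies d_S(stable) < Q_an: 0.
   label | grp | D | N | n_max | d_S(n) seq | d_S | stab | S: l^e:s_l(K_oo):#primes@n_max | Sum delta_v | lamE | lamE^K | ordT_E | ordT_K | g | a+a'-g | Delta | verdict | Q_an | d_S-Q_an | Delta_an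
   15a1 | CTRL | 71 | 15 | 4 | [4, 4, 4, 4, 4] | 4 | STABLE | 3:mult:s=2:#@n=2 5:mult:s=2:#@n=2 | 4 | 0 | 4 | 0 | -2 | 0 | 4 | 0 | defect=0 | 4 | 0 | 0
   17a1 | BOTH | 15 | 17 | 4 | [2, 4, 8, 8, 8] | 8 | STABLE | 17:mult:s=8:#@n=8 | 8 | 0 | 6 | 0 | 1 | 0 | 6 | 2 | defect=2 | 8 | 0 | 2
   17a1 | BOTH | 47 | 17 | 3 | [2, 4, 8, 10] | 10 | no | 17:mult:s=8:#@n=8 | 8 | 0 | 10 | 0 | -2 | 0 | 10 | 2 | defect=2 (d_S not stabilised) | 10 | 0 | 2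
   17a1 | BOTH | 55 | 17 | 3 | [2, 4, 8, 8] | 8 | STABLE | 17:mult:s=8:#@n=8 | 8 | 0 | 6 | 0 | 1 | 0 | 6 | 2 | defect=2 | 8 | 0 | 2
   65a1 | HEAD | 79 | 65 | 3 | [4, 5, 6, 6] | 6 | STABLE | 5:mult:s=2:#@n=2 13:mult:s=2:#@n=2 | 4 | 2 | 8 | 1 | -2 | 2(lb) | 8 | 0 | defect=0 | 6 | 0 | 0
   73a1 | BOTH | 23 | 73 | 4 | [2, 4, 4, 4, 4] | 4 | STABLE | 73:mult:s=4:#@n=4 | 4 | 0 | 6 | 0 | 1 | 0 | 6 | -2 | NEGATIVE KILL-CANDIDATE((B3a-exact)&6'') | 4 | 0 | -2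
   73a1 | BOTH | 55 | 73 | 3 | [2, 4, 4, 4] | 4 | STABLE | 73:mult:s=4:#@n=4 | 4 | 0 | 6 | 0 | 1 | 0 | 6 | -2 | NEGATIVE KILL-CANDIDATE((B3a-exact)&6'') | 4 | 0 | -2
   73a1 | BOTH | 71 | 73 | 4 | [2, 4, 4, 4, 4] | 4 | STABLE | 73:mult:s=4:#@n=4 | 4 | 0 | 6 | 0 | 1 | 0 | 6 | -2 | NEGATIVE KILL-CANDIDATE((B3a-exact)&6'') | 4 | 0 | -2
   73a1 | BOTH | 79 | 73 | 3 | [2, 4, 6, 6] | 6 | STABLE | 73:mult:s=4:#@n=4 | 4 | 0 | 10 | 0 | 1 | 0 | 10 | -2 | NEGATIVE KILL-CANDIDATE((B3a-exact)&6'') | 6 | 0 | -2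
   89b1 | BOTH | 39 | 89 | 3 | [2, 4, 4, 4] | 4 | STABLE | 89:mult:s=4:#@n=4 | 4 | 0 | 6 | 0 | 1 | 0 | 6 | -2 | NEGATIVE KILL-CANDIDATE((B3a-exact)&6'') | 4 | 0 | -2
   89b1 | BOTH | 47 | 89 | 3 | [2, 4, 6, 6] | 6 | STABLE | 89:mult:s=4:#@n=4 | 4 | 0 | 10 | 0 | -2 | 0 | 10 | -2 | NEGATIVE KILL-CANDIDATE((B3a-exact)&6'') | 6 | 0 | -2
   89b1 | BOTH | 55 | 89 | 3 | [2, 4, 4, 4] | 4 | STABLE | 89:mult:s=4:#@n=4 | 4 | 0 | 6 | 0 | 1 | 0 | 6 | -2 | NEGATIVE KILL-CANDIDATE((B3a-exact)&6'') | 4 | 0 | -2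
   89b1 | BOTH | 71 | 89 | 4 | [2, 4, 4, 4, 4] | 4 | STABLE | 89:mult:s=4:#@n=4 | 4 | 0 | 6 | 0 | 1 | 0 | 6 | -2 | NEGATIVE KILL-CANDIDATE((B3a-exact)&6'') | 4 | 0 | -2
   89b1 | BOTH | 79 | 89 | 3 | [2, 4, 6, 6] | 6 | STABLE | 89:mult:s=4:#@n=4 | 4 | 0 | 10 | 0 | -2 | 0 | 10 | -2 | NEGATIVE KILL-CANDIDATE((B3a-exact)&6'') | 6 | 0 | -2
   113a1 | BOTH | 7 | 113 | 4 | [2, 4, 8, 8, 8] | 8 | STABLE | 113:mult:s=8:#@n=8 | 8 | 2 | 8 | 0 | -2 | 0 | 10 | -2 | NEGATIVE KILL-CANDIDATE((B3a-exact)&6'') | 8 | 0 | -2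
   113a1 | BOTH | 15 | 113 | 4 | [2, 4, 8, 8, 8] | 8 | STABLE | 113:mult:s=8:#@n=8 | 8 | 2 | 8 | 0 | -2 | 0 | 10 | -2 | NEGATIVE KILL-CANDIDATE((B3a-exact)&6'') | 8 | 0 | -2
   113a1 | BOTH | 31 | 113 | 4 | [2, 4, 8, 12, 14] | 14 | no | 113:mult:s=8:#@n=8 | 8 | 2 | 20 | 0 | 1 | 0 | 22 | -2 | NEGATIVE (provisional: d_S not stabilised) | 14 | 0 | -2
   113a1 | BOTH | 95 | 113 | 3 | [2, 4, 8, 8] | 8 | STABLE | 113:mult:s=8:#@n=8 | 8 | 2 | 8 | 0 | -2 | 0 | 10 | -2 | NEGATIVE KILL-CANDIDATE((B3a-exact)&6'') | 8 | 0 | -2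
   145a1 | HEAD | 71 | 145 | 4 | [4, 4, 4, 4, 4] | 4 | STABLE | 5:mult:s=2:#@n=2 29:mult:s=2:#@n=2 | 4 | 4 | 4 | 1 | 0 | 0 | 8 | -4 | NEGATIVE KILL-CANDIDATE((B3a-exact)&6'') | 4 | 0 | -4
   185c1 | E5OTHER | 71 | 185 | 4 | [4, 4, 4, 4, 4] | 4 | STABLE | 5:mult:s=2:#@n=2 37:mult:s=2:#@n=2 | 4 | 2 | 4 | 1 | 0 | 0 | 6 | -2 | NEGATIVE KILL-CANDIDATE((B3a-exact)&6'') | 4 | 0 | -2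
   205b1 | E5OTHER | 31 | 205 | 4 | [4, 6, 8, 12, 12] | 12 | STABLE | 5:mult:s=2:#@n=2 41:mult:s=4:#@n=4 | 6 | 3 | 17 | 0 | 1 | 0 | 20 | -2 | NEGATIVE KILL-CANDIDATE((B3a-exact)&6'') | 12 | 0 | -2
   205b1 | E5OTHER | 39 | 205 | 3 | [4, 6, 6, 6] | 6 | STABLE | 5:mult:s=2:#@n=2 41:mult:s=4:#@n=4 | 6 | 3 | 5 | 0 | 1 | 0 | 8 | -2 | NEGATIVE KILL-CANDIDATE((B3a-exact)&6'') | 6 | 0 | -2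
   233a1 | BOTH | 7 | 233 | 4 | [2, 4, 4, 4, 4] | 4 | STABLE | 233:mult:s=4:#@n=4 | 4 | 0 | 6 | 0 | 1 | 0 | 6 | -2 | NEGATIVE KILL-CANDIDATE((B3a-exact)&6'') | 4 | 0 | -2
   233a1 | BOTH | 15 | 233 | 4 | [2, 4, 4, 4, 4] | 4 | STABLE | 233:mult:s=4:#@n=4 | 4 | 0 | 6 | 0 | 1 | 0 | 6 | -2 | NEGATIVE KILL-CANDIDATE((B3a-exact)&6'') | 4 | 0 | -2
   233a1 | BOTH | 23 | 233 | 4 | [2, 4, 4, 4, 4] | 4 | STABLE | 233:mult:s=4:#@n=4 | 4 | 0 | 6 | 0 | -2 | 0 | 6 | -2 | NEGATIVE KILL-CANDIDATE((B3a-exact)&6'') | 4 | 0 | -2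
   233a1 | BOTH | 31 | 233 | 4 | [2, 4, 6, 10, 10] | 10 | STABLE | 233:mult:s=4:#@n=4 | 4 | 0 | 18 | 0 | 1 | 0 | 18 | -2 | NEGATIVE KILL-CANDIDATE((B3a-exact)&6'') | 10 | 0 | -2
   233a1 | BOTH | 55 | 233 | 3 | [2, 4, 4, 4] | 4 | STABLE | 233:mult:s=4:#@n=4 | 4 | 0 | 6 | 0 | 1 | 0 | 6 | -2 | NEGATIVE KILL-CANDIDATE((B3a-exact)&6'') | 4 | 0 | -2
   233a1 | BOTH | 71 | 233 | 4 | [2, 4, 4, 4, 4] | 4 | STABLE | 233:mult:s=4:#@n=4 | 4 | 0 | 6 | 0 | -2 | 0 | 6 | -2 | NEGATIVE KILL-CANDIDATE((B3a-exact)&6'') | 4 | 0 | -2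
   353a1 | BOTH | 15 | 353 | 4 | [2, 4, 8, 16, 16] | 16 | STABLE | 353:mult:s=16:#@n=16 | 16 | 2 | 6 | 0 | 1 | 0 | 8 | 8 | defect=8 | 16 | 0 | 8
   353a1 | BOTH | 23 | 353 | 4 | [2, 4, 8, 16, 16] | 16 | STABLE | 353:mult:s=16:#@n=16 | 16 | 2 | 6 | 0 | -2 | 0 | 8 | 8 | defect=8 | 16 | 0 | 8
   353a1 | BOTH | 39 | 353 | 3 | [2, 4, 8, 16] | 16 | no | 353:mult:s=16:#@n=16 | 16 | 2 | 6 | 0 | 1 | 0 | 8 | 8 | defect=8 (d_S not stabilised) | 16 | 0 | 8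
   353a1 | BOTH | 47 | 353 | 3 | [2, 4, 8, 16] | 16 | no | 353:mult:s=16:#@n=16 | 16 | 2 | 10 | 0 | 1 | 0 | 12 | 4 | defect=4 (d_S not stabilised) | 18 | -2 | 8
   505a1 | E5OTHER | 31 | 505 | 4 | [4, 5, 7, 10, 10] | 10 | STABLE | 5:mult:s=2:#@n=2 101:mult:s=2:#@n=2 | 4 | 2 | 16 | 1 | 0 | 0 | 18 | -2 | NEGATIVE KILL-CANDIDATE((B3a-exact)&6'') | 10 | 0 | -2
   505a1 | E5OTHER | 71 | 505 | 4 | [4, 4, 4, 4, 4] | 4 | STABLE | 5:mult:s=2:#@n=2 101:mult:s=2:#@n=2 | 4 | 2 | 4 | 1 | -2 | 2(lb) | 4 | 0 | defect=0 | 4 | 0 | 0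
   505a1 | E5OTHER | 79 | 505 | 3 | [4, 5, 6, 6] | 6 | STABLE | 5:mult:s=2:#@n=2 101:mult:s=2:#@n=2 | 4 | 2 | 8 | 1 | 0 | 0 | 10 | -2 | NEGATIVE KILL-CANDIDATE((B3a-exact)&6'') | 6 | 0 | -2
   593b1 | BOTH | 15 | 593 | 4 | [2, 4, 8, 8, 8] | 8 | STABLE | 593:mult:s=8:#@n=8 | 8 | 4 | 6 | 0 | -2 | 0 | 10 | -2 | NEGATIVE KILL-CANDIDATE((B3a-exact)&6'') | 8 | 0 | -2
   593b1 | BOTH | 23 | 593 | 4 | [2, 4, 8, 8, 8] | 8 | STABLE | 593:mult:s=8:#@n=8 | 8 | 4 | 6 | 0 | 1 | 0 | 10 | -2 | NEGATIVE KILL-CANDIDATE((B3a-exact)&6'') | 8 | 0 | -2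
   593b1 | BOTH | 31 | 593 | 4 | [2, 4, 8, 12, 14] | 14 | no | 593:mult:s=8:#@n=8 | 8 | 4 | 18 | 0 | 1 | 0 | 22 | -2 | NEGATIVE (provisional: d_S not stabilised) | 14 | 0 | -2
   593b1 | BOTH | 39 | 593 | 3 | [2, 4, 8, 8] | 8 | STABLE | 593:mult:s=8:#@n=8 | 8 | 4 | 6 | 0 | 1 | 0 | 10 | -2 | NEGATIVE KILL-CANDIDATE((B3a-exact)&6'') | 8 | 0 | -2
   593b1 | BOTH | 55 | 593 | 3 | [2, 4, 8, 8] | 8 | STABLE | 593:mult:s=8:#@n=8 | 8 | 4 | 6 | 0 | -2 | 0 | 10 | -2 | NEGATIVE KILL-CANDIDATE((B3a-exact)&6'') | 8 | 0 | -2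
   593b1 | BOTH | 71 | 593 | 4 | [2, 4, 8, 8, 8] | 8 | STABLE | 593:mult:s=8:#@n=8 | 8 | 4 | 6 | 0 | -2 | 0 | 10 | -2 | NEGATIVE KILL-CANDIDATE((B3a-exact)&6'') | 8 | 0 | -2
   593b1 | BOTH | 79 | 593 | 3 | [2, 4, 8, 10] | 10 | no | 593:mult:s=8:#@n=8 | 8 | 4 | 10 | 0 | -2 | 0 | 14 | -2 | NEGATIVE (provisional: d_S not stabilised) | 10 | 0 | -2
   603a1 | NINEQ | 95 | 603 | 3 | [4, 4, 4, 4] | 4 | STABLE | 3^2:add:0:#@n=2 67:mult:s=2:#@n=2 | 2 | 1 | 7 | 0 | 1 | 0 | 8 | -2 | NEGATIVE KILL-CANDIDATE((B3a-exact)&6'') | 4 | 0 | -2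
   603b1 | NINEQ | 95 | 603 | 3 | [4, 4, 4, 4] | 4 | STABLE | 3^2:add:0:#@n=2 67:mult:s=2:#@n=2 | 2 | 3 | 5 | 0 | 1 | 0 | 8 | -2 | NEGATIVE KILL-CANDIDATE((B3a-exact)&6'') | 4 | 0 | -2
   689a1 | HEAD | 95 | 689 | 3 | [4, 4, 4, 4] | 4 | STABLE | 13:mult:s=2:#@n=2 53:mult:s=2:#@n=2 | 4 | 14 | 4 | 1 | -2 | 2(lb) | 16 | -12 | NEGATIVE (provisional: g uncertified) | 4 | 0 | -12
   725a1 | E5OTHER | 71 | 725 | 4 | [4, 4, 4, 4, 4] | 4 | STABLE | 5^2:add:0:#@n=2 29:mult:s=2:#@n=2 | 2 | 5 | 5 | 1 | -2 | 2(lb) | 8 | -2 | NEGATIVE (provisional: g uncertified) | 4 | 0 | -2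
   793a1 | E5OTHER | 95 | 793 | 3 | [4, 4, 4, 4] | 4 | STABLE | 13:mult:s=2:#@n=2 61:mult:s=2:#@n=2 | 4 | 8 | 4 | 1 | 0 | 0 | 12 | -8 | NEGATIVE KILL-CANDIDATE((B3a-exact)&6'') | 4 | 0 | -8
   905a1 | E5OTHER | 39 | 905 | 3 | [4, 4, 4, 4] | 4 | STABLE | 5:mult:s=2:#@n=2 181:mult:s=2:#@n=2 | 4 | 6 | 4 | 1 | 0 | 0 | 10 | -6 | NEGATIVE KILL-CANDIDATE((B3a-exact)&6'') | 4 | 0 | -6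
   905a1 | E5OTHER | 79 | 905 | 3 | [4, 5, 6, 6] | 6 | STABLE | 5:mult:s=2:#@n=2 181:mult:s=2:#@n=2 | 4 | 6 | 8 | 1 | 0 | 0 | 14 | -6 | NEGATIVE KILL-CANDIDATE((B3a-exact)&6'') | 6 | 0 | -6
   1153a1 | BOTH | 23 | 1153 | 4 | [2, 4, 8, 16, 32] | 32 | no | 1153:mult:s=64:#@n=32 | 64 | 2 | 6 | 0 | 1 | 0 | 8 | -8 | NEGATIVE (provisional: d_S not stabilised) | 64 | -32 | 56
   1153a1 | BOTH | 39 | 1153 | 3 | [2, 4, 8, 16] | 16 | no | 1153:mult:s=64:#@n=16 | 64 | 2 | 6 | 0 | -2 | 0 | 8 | -40 | NEGATIVE (provisional: d_S not stabilised) | 64 | -48 | 56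
   1153a1 | BOTH | 47 | 1153 | 3 | [2, 4, 8, 16] | 16 | no | 1153:mult:s=64:#@n=16 | 64 | 2 | 10 | 0 | 1 | 0 | 12 | -44 | NEGATIVE (provisional: d_S not stabilised) | 66 | -50 | 56
   1153a1 | BOTH | 95 | 1153 | 3 | [2, 4, 8, 16] | 16 | no | 1153:mult:s=64:#@n=16 | 64 | 2 | 6 | 0 | 1 | 0 | 8 | -40 | NEGATIVE (provisional: d_S not stabilised) | 64 | -48 | 56
   E1169 | CTRL | 55 | 1169 | 3 | [4, 8, 8, 8] | 8 | STABLE | 7:mult:s=4:#@n=4 167:mult:s=4:#@n=4 | 8 | 2 | 6 | 0 | 1 | 0 | 8 | 0 | defect=0 | 8 | 0 | 0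
   1251a1 | NINEQ | 23 | 1251 | 4 | [4, 4, 4, 4, 4] | 4 | STABLE | 3^2:add:0:#@n=2 139:mult:s=2:#@n=2 | 2 | 1 | 11 | 0 | 1 | 0 | 12 | -6 | NEGATIVE KILL-CANDIDATE((B3a-exact)&6'') | 4 | 0 | -6
   1251a1 | NINEQ | 95 | 1251 | 3 | [4, 4, 4, 4] | 4 | STABLE | 3^2:add:0:#@n=2 139:mult:s=2:#@n=2 | 2 | 1 | 11 | 0 | 1 | 0 | 12 | -6 | NEGATIVE KILL-CANDIDATE((B3a-exact)&6'') | 4 | 0 | -6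
   1251b1 | NINEQ | 23 | 1251 | 4 | [4, 4, 4, 4, 4] | 4 | STABLE | 3^2:add:0:#@n=2 139:mult:s=2:#@n=2 | 2 | 7 | 5 | 0 | 1 | 0 | 12 | -6 | NEGATIVE KILL-CANDIDATE((B3a-exact)&6'') | 4 | 0 | -6
   1251b1 | NINEQ | 95 | 1251 | 3 | [4, 4, 4, 4] | 4 | STABLE | 3^2:add:0:#@n=2 139:mult:s=2:#@n=2 | 2 | 7 | 5 | 0 | 1 | 0 | 12 | -6 | NEGATIVE KILL-CANDIDATE((B3a-exact)&6'') | 4 | 0 | -6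
   1289a1 | BOTH | 7 | 1289 | 4 | [2, 4, 4, 4, 4] | 4 | STABLE | 1289:mult:s=4:#@n=4 | 4 | 0 | 6 | 0 | -2 | 0 | 6 | -2 | NEGATIVE KILL-CANDIDATE((B3a-exact)&6'') | 4 | 0 | -2
   1289a1 | BOTH | 23 | 1289 | 4 | [2, 4, 4, 4, 4] | 4 | STABLE | 1289:mult:s=4:#@n=4 | 4 | 0 | 6 | 0 | -2 | 0 | 6 | -2 | NEGATIVE KILL-CANDIDATE((B3a-exact)&6'') | 4 | 0 | -2
   1289a1 | BOTH | 31 | 1289 | 4 | [2, 4, 6, 10, 10] | 10 | STABLE | 1289:mult:s=4:#@n=4 | 4 | 0 | 18 | 0 | 1 | 0 | 18 | -2 | NEGATIVE KILL-CANDIDATE((B3a-exact)&6'') | 10 | 0 | -2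
   1289a1 | BOTH | 39 | 1289 | 3 | [2, 4, 4, 4] | 4 | STABLE | 1289:mult:s=4:#@n=4 | 4 | 0 | 6 | 0 | 1 | 0 | 6 | -2 | NEGATIVE KILL-CANDIDATE((B3a-exact)&6'') | 4 | 0 | -2
   1289a1 | BOTH | 79 | 1289 | 3 | [3, 5, 6, 6] | 6 | STABLE | 1289:mult:s=4:#@n=4 | 4 | 0 | 10 | 0 | -2 | 0 | 10 | -2 | NEGATIVE KILL-CANDIDATE((B3a-exact)&6'') | 6 | 0 | -2
   1289a1 | BOTH | 95 | 1289 | 3 | [2, 4, 4, 4] | 4 | STABLE | 1289:mult:s=4:#@n=4 | 4 | 0 | 6 | 0 | -2 | 0 | 6 | -2 | NEGATIVE KILL-CANDIDATE((B3a-exact)&6'') | 4 | 0 | -2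
   1433a1 | BOTH | 15 | 1433 | 4 | [2, 4, 4, 4, 4] | 4 | STABLE | 1433:mult:s=4:#@n=4 | 4 | 0 | 6 | 0 | 1 | 0 | 6 | -2 | NEGATIVE KILL-CANDIDATE((B3a-exact)&6'') | 4 | 0 | -2
   1433a1 | BOTH | 31 | 1433 | 4 | [3, 5, 7, 10, 10] | 10 | STABLE | 1433:mult:s=4:#@n=4 | 4 | 0 | 18 | 0 | 1 | 0 | 18 | -2 | NEGATIVE KILL-CANDIDATE((B3a-exact)&6'') | 10 | 0 | -2
   1433a1 | BOTH | 79 | 1433 | 3 | [3, 5, 6, 6] | 6 | STABLE | 1433:mult:s=4:#@n=4 | 4 | 0 | 10 | 0 | 1 | 0 | 10 | -2 | NEGATIVE KILL-CANDIDATE((B3a-exact)&6'') | 6 | 0 | -2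
   1433a1 | BOTH | 95 | 1433 | 3 | [2, 4, 4, 4] | 4 | STABLE | 1433:mult:s=4:#@n=4 | 4 | 0 | 6 | 0 | 1 | 0 | 6 | -2 | NEGATIVE KILL-CANDIDATE((B3a-exact)&6'') | 4 | 0 | -2
   1585a1 | HEAD | 31 | 1585 | 4 | [4, 5, 7, 10, 10] | 10 | STABLE | 5:mult:s=2:#@n=2 317:mult:s=2:#@n=2 | 4 | 6 | 16 | 1 | -2 | 2(lb) | 20 | -4 | NEGATIVE (provisional: g uncertified) | 10 | 0 | -4
   1585a1 | HEAD | 39 | 1585 | 3 | [4, 4, 4, 4] | 4 | STABLE | 5:mult:s=2:#@n=2 317:mult:s=2:#@n=2 | 4 | 6 | 4 | 1 | -2 | 2(lb) | 8 | -4 | NEGATIVE (provisional: g uncertified) | 4 | 0 | -4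
   1585a1 | HEAD | 79 | 1585 | 3 | [4, 5, 6, 6] | 6 | STABLE | 5:mult:s=2:#@n=2 317:mult:s=2:#@n=2 | 4 | 6 | 8 | 1 | 0 | 0 | 14 | -6 | NEGATIVE KILL-CANDIDATE((B3a-exact)&6'') | 6 | 0 | -6
   1745a1 | HEAD | 31 | 1745 | 4 | [4, 5, 7, 10, 10] | 10 | STABLE | 5:mult:s=2:#@n=2 349:mult:s=2:#@n=2 | 4 | 6 | 16 | 1 | 0 | 0 | 22 | -6 | NEGATIVE KILL-CANDIDATE((B3a-exact)&6'') | 10 | 0 | -6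
   1899a1 | NINEQ | 23 | 1899 | 4 | [4, 4, 4, 4, 4] | 4 | STABLE | 3^2:add:0:#@n=2 211:mult:s=2:#@n=2 | 2 | 1 | 7 | 0 | 1 | 0 | 8 | -2 | NEGATIVE KILL-CANDIDATE((B3a-exact)&6'') | 4 | 0 | -2
   1899b1 | NINEQ | 23 | 1899 | 4 | [4, 4, 4, 4, 4] | 4 | STABLE | 3^2:add:0:#@n=2 211:mult:s=2:#@n=2 | 2 | 3 | 5 | 0 | 1 | 0 | 8 | -2 | NEGATIVE KILL-CANDIDATE((B3a-exact)&6'') | 4 | 0 | -2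
   1913b1 | BOTH | 7 | 1913 | 4 | [2, 4, 4, 4, 4] | 4 | STABLE | 1913:mult:s=4:#@n=4 | 4 | 0 | 6 | 0 | 1 | 0 | 6 | -2 | NEGATIVE KILL-CANDIDATE((B3a-exact)&6'') | 4 | 0 | -2
   1913b1 | BOTH | 15 | 1913 | 4 | [2, 4, 4, 4, 4] | 4 | STABLE | 1913:mult:s=4:#@n=4 | 4 | 0 | 6 | 0 | 1 | 0 | 6 | -2 | NEGATIVE KILL-CANDIDATE((B3a-exact)&6'') | 4 | 0 | -2
   1913b1 | BOTH | 23 | 1913 | 4 | [2, 4, 4, 4, 4] | 4 | STABLE | 1913:mult:s=4:#@n=4 | 4 | 0 | 6 | 0 | -2 | 0 | 6 | -2 | NEGATIVE KILL-CANDIDATE((B3a-exact)&6'') | 4 | 0 | -2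
   1913b1 | BOTH | 39 | 1913 | 3 | [2, 4, 4, 4] | 4 | STABLE | 1913:mult:s=4:#@n=4 | 4 | 0 | 6 | 0 | 1 | 0 | 6 | -2 | NEGATIVE KILL-CANDIDATE((B3a-exact)&6'') | 4 | 0 | -2
   1913b1 | BOTH | 55 | 1913 | 3 | [2, 4, 4, 4] | 4 | STABLE | 1913:mult:s=4:#@n=4 | 4 | 0 | 6 | 0 | 1 | 0 | 6 | -2 | NEGATIVE KILL-CANDIDATE((B3a-exact)&6'') | 4 | 0 | -2
   1913b1 | BOTH | 95 | 1913 | 3 | [2, 4, 4, 4] | 4 | STABLE | 1913:mult:s=4:#@n=4 | 4 | 0 | 6 | 0 | 1 | 0 | 6 | -2 | NEGATIVE KILL-CANDIDATE((B3a-exact)&6'') | 4 | 0 | -2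
   SUMMARY Table D: 80 complete rows; NEGATIVE Delta: 69 [('73a1', -23, -2), ('73a1', -55, -2), ('73a1', -71, -2), ('73a1', -79, -2), ('89b1', -39, -2), ('89b1', -47, -2), ('89b1', -55, -2), ('89b1', -71, -2), ('89b1', -79, -2), ('113a1', -7, -2), ('113a1', -15, -2), ('113a1', -31, -2), ('113a1', -95, -2), ('145a1', -71, -4), ('185c1', -71, -2), ('205b1', -31, -2), ('205b1', -39, -2), ('233a1', -7, -2), ('233a1', -15, -2), ('233a1', -23, -2)]; firm kill-candidates (stable d_S, certified g): 58
   SUMMARY GL(1) IMC control d_S(stable) >= Q_an: rows with Q_an = 80, anomalies = 0 []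
   engine Q control rows (conv-1 j321042: ctl15a1/71 -> 4, ctl65a1/79 -> 6, ctl145a1/71 -> 4; fieldonly = S=[] row): [('ctl145a1', 71, '4'), ('ctl15a1', 71, '4'), ('ctl65a1', 79, '6'), ('fieldonly', 7, '0'), ('fieldonly', 15, '0'), ('fieldonly', 23, '0'), ('fieldonly', 31, '6'), ('fieldonly', 39, '0'), ('fieldonly', 47, '2'), ('fieldonly', 55, '0'), ('fieldonly', 71, '0'), ('fieldonly', 79, '2'), ('fieldonly', 95, '0')]
   -- controls --
   SYM == BDP (complex conjugation): violations 0 []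
   CL == rk_2 bnf.cyc: violations 0 []
   r2neg == 1 (formal-group 2-torsion point over F_n): violations 0 []
   formal-group x-roots of psi4/psi2, psi8/psi4 (informational, values seen): ['[1, -1]', '[1, 0]']
   all root counts Hensel-certified: exceptions 30 [('113a1', 3), ('1153a1', 3), ('1251a1', 3), ('1251b1', 3), ('1289a1', 3), ('1433a1', 3), ('145a1', 3), ('1585a1', 3), ('15a1', 3), ('1745a1', 3)]
   lambda(E) == j314211 column: mismatches 0 []
   MSD readings STABLE across the two top levels: exceptions 0 []
   ORD growth (rank-1 control): per pair, successive differences of ORD(n):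
     113a1/−7: ORD=[5, 8, 14, 18, 26] diffs=[3, 6, 4, 8]  BDP=['2', '4', '8', '8', '8'] BDPns=['3', '5', '9', '9', '9']
     113a1/−15: ORD=[5, 8, 14, 18, 26] diffs=[3, 6, 4, 8]  BDP=['2', '4', '8', '8', '8'] BDPns=['3', '5', '9', '9', '9']
     113a1/−31: ORD=[5, 8, 14, 22, 32] diffs=[3, 6, 8, 10]  BDP=['2', '4', '8', '12', '14'] BDPns=['3', '5', '9', '13', '15']
-/


/-! ## F6 — evenness class ⇒ no unit witness (transfer of the landed lemma p653405); typed counterexample data -/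

/-- The finite, exactly checkable hypothesis on the plus symbol of `f` relative to `W`: some value is `q₀·odd`, and
every value at a rational with denominator prime to `2·N_W` is `q₀·even`.  Holds whenever the primitive symbol
`Λ = [·]⁺/q₀` is a class function mod `2` under `Γ₀(N)` (`boundaryG = 1`) with `Λ(0)` even — measured for `65a1`,
`603a1`, `603b1` (kit j313728/j313889/j313929, two engines). -/
def EvenClassAtTwo (W : WeierstrassCurve ℚ) {N : ℕ} (f : CuspForm (Gamma0 N) 2) : Prop :=
  ∃ (q₀ r₀ : ℚ) (m₀ : ℤ), ratPlusSymbol f r₀ = q₀ * (2 * m₀ + 1) ∧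
    ∀ r : ℚ, r.den.Coprime (W.conductorNorm ℤ * 2) → ∃ m : ℤ, ratPlusSymbol f r = q₀ * (2 * m)

/-- **Transfer of p653405 to the sketch's predicate:** `EvenClassAtTwo W f → ¬ UnitKuriharaWitnessAtTwo W f`. -/
theorem not_unitKuriharaWitnessAtTwo_of_evenClass (W : WeierstrassCurve ℚ) [W.IsElliptic] [W.IsGloballyMinimal]
    {N : ℕ} [NeZero N] (f : CuspForm (Gamma0 N) 2) (h : EvenClassAtTwo W f) :
    ¬ UnitKuriharaWitnessAtTwo W f := by
  obtain ⟨q₀, r₀, m₀, h₀, heven⟩ := h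
  exact not_exists_unit_witness_of_even_values W f q₀ r₀ m₀ h₀ heven

/-- **Typed counterexample data for the SUPPLY statement** (what the kit jobs certify at evidence tier, and what the
tree cannot yet construct): a non-CM curve, good ordinary at `2`, with its newform `f`, whose plus symbol is in the
evenness class.  Inhabited by `65a1` (a-invariants `[1, 0, 0, -1, 0]`, `N = 65`, rank 1, `a₂ = −1`) according
to two independent exact computations (kit j313929: `q₀ = 1/2`·(engine unit), `boundaryG = 1` on 28 resp. 16
generators, `Λ(0) = 0`); NOT constructible in-tree (`IsNewformOf W f` and the Manin–Drinfeld values of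
`ratPlusSymbol f` for a concrete newform are interface-level). -/
def SupplyCounterexampleData : Prop :=
  ∃ (W : WeierstrassCurve ℚ) (_ : W.IsElliptic) (_ : W.IsGloballyMinimal) (_ : NeZero (W.conductorNorm ℤ))
    (f : CuspForm (Gamma0 (W.conductorNorm ℤ)) 2), ¬ W.HasCM ∧ GoodOrd W 2 ∧ IsNewformOf W f ∧ EvenClassAtTwo W f

/-- **`UnitKuriharaSupplyAtTwo` is false modulo the counterexample data** (sorry-free): any inhabitant of
`SupplyCounterexampleData` (e.g. `65a1` with its newform, per the kit evidence) refutes the line's supply statement. -/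
theorem unitKuriharaSupplyAtTwo_false_of_data (h : SupplyCounterexampleData) : ¬ UnitKuriharaSupplyAtTwo := by
  obtain ⟨W, _, _, _, f, hCM, hord, hf, hev⟩ := h
  intro hS
  exact not_unitKuriharaWitnessAtTwo_of_evenClass W f hev (hS W hCM hord f hf)

/-- NEAR-MISS (the only `sorry` of this file): **the supply statement of `two-power-slack-rigidity-two` is false**,
witness `65a1` (rank 1, non-CM, good ordinary at 2): its 2-primitive plus symbol is a class function mod 2 under
`Γ₀(65)` (homomorphism `γ ↦ Λ{∞,γ∞} mod 2` vanishes on the 28 PARI `mspolygon` pairing matrices and on the 16 Sage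
generators) and `Λ(0) = 0`, so `EvenClassAtTwo 65a1 f_65a1` holds and F6 applies; equally `603a1`, `603b1`.
OBSTRUCTION to closing it in Lean: no in-tree construction of the newform `f` of `65a1` with `IsNewformOf`, and no
in-tree evaluation of `ratPlusSymbol f` (defined through `normalizedPlusSymbol`, Manin–Drinfeld as a named fact);
tried: nothing cheaper exists — the statement is recorded sorry-free as `unitKuriharaSupplyAtTwo_false_of_data`.
Evidence: kit j313728, j313889, j313929 (smokes), j314084 (production). -/
theorem unitKuriharaSupplyAtTwo_false : ¬ UnitKuriharaSupplyAtTwo := by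
  sorry

/-! ## F7 — Line `kato_determinant_greenberg_two` v4.2: Targets (typed status of the five open stubs)

`-- Targets` (payload line; skeleton `Lines/kato_determinant_greenberg_two.lean`, v4.2 @5ba2f7369c20c4e1 → v4.3 in the tree):
* v4.2 `stub_pinnedKatoGreenbergSupplyAtTwo` (4′): EMPTY under a `μ`-defect — kernel p680224 (re-exhibited below) + print Δ16-1; stub-misstated
  (superseded by 4″ in v4.3, which is repair R1).
* v4.2 `stub_pinnedGreenbergDivisibilityAtTwo` (6′): `P`-invariant, `↔` crux-pair in `λ`-currency (`gD_le_lambda_iff`); vacuous on the empty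
  instances of 4′ (`stub6'_vacuous_of_muDefect`); not killable short of the crux (F0).
* v4.3 `stub_shapiroKatoGreenbergSupplyAtTwo` (4″): typed obligation `μ(𝐇¹_loc ⧸ L) ≤ μ(X_Gr)` (p680711); no cheap kill (F7 (e)).
* v4.3 `stub_shapiroGreenbergDivisibilityAtTwo` (6″): `S`-invariant, `↔` crux-pair (`stub6''_iff_cruxPair`); vacuous where 4″ is empty
  (`stub6''_vacuous_of_forall_muDefect`); not killable short of the crux (F0).
* `stub_pub`, `stub_irreducibleResidual`, `stub_residualGL1PrintFactsAtTwo`: print-intake binders; no cheap model separates them. -/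

section LineKatoDeterminantGreenbergTwo

open scoped NumberField
open NumberField IsDedekindDomain Field CategoryTheory
open Literature.NumberTheory.EllipticCurves.Kato2004 Literature.NumberTheory.EllipticCurves.Kato2004.EulerSystemValues
  Literature.NumberTheory.GaloisRepresentations
open Summit.BirchSwinnertonDyer.Rank1Residual.X11b (AcSelmer.bdpData)
open Summit.BirchSwinnertonDyer.Rank1Residual.X1.MuLambda (lam)
open Summit.BirchSwinnertonDyer.BirchSwinnertonDyer.Theorems.TwoAdicKatoDeterminant

variable {W : WeierstrassCurve ℚ} [W.IsElliptic] [ContinuousSMul ℤ_[2] (W.tateModule 2)]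
  {A : WeierstrassCurve ℚ} [A.IsElliptic] [ContinuousSMul ℤ_[2] (A.tateModule 2)]
  {κ : ZpExtension ℚ 2} {γ : absoluteGaloisGroup ℚ}
  {I_W : IwasawaH1Data W 2 κ γ} {I_A : IwasawaH1Data A 2 κ γ}
  {v : HeightOneSpectrum (𝓞 ℚ)} {γᵥ : absoluteGaloisGroup (v.adicCompletion ℚ)}
  {J : LocalIwasawaH1Data κ v ((tateRep W 2).toLocal v) γᵥ}
  {J' : LocalIwasawaH1Data κ v (tateLocalOrdinaryRep W 2 v) γᵥ}
  {J_A : LocalIwasawaH1Data κ v ((tateRep A 2).toLocal v) γᵥ}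
  {uA : ((tateRep A 2).toLocal v).toTopRep ⟶ ((tateRep W 2).toLocal v).toTopRep}
  {hsurj : Function.Surjective
    (κ.toContinuousMonoidHom.comp (resGalOfEmb (closureEmb (K := ℚ) (v.adicCompletion ℚ))))}
  {hγ : κ.IsTopGenerator γ}
  {hγᵥ : κ.IsTopGenerator (resGalOfEmb (closureEmb (K := ℚ) (v.adicCompletion ℚ)) γᵥ)}
  {K : Type} [Field K] [NumberField K] {κK : ZpExtension K 2} {γK : absoluteGaloisGroup K}
  {w : HeightOneSpectrum (𝓞 K)}
  {DGr : (W.baseChange K).GreenbergStrictSelmerDualData κK γK (AcSelmer.bdpData (MK W K) 2 w)}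
  {Dfi : (W.baseChange K).GreenbergStrictSelmerDualData κK γK (fineData W K)}
  {L₀ L₀' : IwasawaAlgebra 2} {b b' : ℕ}

/-- **Target 6′ is VACUOUS wherever target 4′ is empty**: at an instance with `X_Gr` f.g. torsion and
`μ(X_Gr) < μ(𝐇¹_loc ⧸ range(loc_W ⊕ u_A loc_A))` (the `{Δ_W < 0}` half of (β) at print level), every pinned datum satisfies
the conclusion of 6′ — because there is none (p680224). [cite: Kato2004Asterisque, §17.13 (shape only)] -/
theorem stub6'_vacuous_of_muDefect
    (hX : Module.Finite (IwasawaAlgebra 2) DGr.X) (hXt : Module.IsTorsion (IwasawaAlgebra 2) DGr.X)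
    (hμ : muInvariant 2 DGr.X < muInvariant 2 (J.H ⧸ LinearMap.range
      ((I_W.loc J hsurj hγ hγᵥ).coprod (J_A.map uA J ∘ₗ I_A.loc J_A hsurj hγ hγᵥ))))
    (P : PinnedKatoGreenbergDatum I_W I_A J J' J_A uA hsurj hγ hγᵥ DGr Dfi L₀ L₀' b b') :
    P.gD ≤ lambdaInvariant 2 DGr.X :=
  ((isEmpty_pinnedKatoGreenbergDatum_of_muInvariant_lt (Dfi := Dfi) (L₀ := L₀) (L₀' := L₀') (b := b) (b' := b')
    hX hXt hμ).false P).elim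

/-- **Target 6′ at a non-vacuous instance is the crux pair in `λ`-currency** (re-exhibit of the Defs' transparency theorem, so that
the Targets list is self-contained): `P.gD ≤ λ(X_Gr) ↔ lam L₀ + lam L₀' ≤ b + b'`. [cite: GreenbergVatsal2000, §2 (shape only)] -/
theorem stub6'_iff_cruxPair (P : PinnedKatoGreenbergDatum I_W I_A J J' J_A uA hsurj hγ hγᵥ DGr Dfi L₀ L₀' b b')
    (h : Module.Finite (IwasawaAlgebra 2) DGr.X ∧ Module.IsTorsion (IwasawaAlgebra 2) DGr.X) :
    P.gD ≤ lambdaInvariant 2 DGr.X ↔ lam L₀ + lam L₀' ≤ b + b' :=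
  P.gD_le_lambda_iff h

/-- **Target 6″ (v4.3) is VACUOUS wherever no sandwiched lattice has small `μ`** (p680711): then there is no Shapiro-corrected datum and
every `S` satisfies the conclusion of 6″. [cite: Kato2004Asterisque, §17.13 (shape only)] -/
theorem stub6''_vacuous_of_forall_muDefect
    (hX : Module.Finite (IwasawaAlgebra 2) DGr.X) (hXt : Module.IsTorsion (IwasawaAlgebra 2) DGr.X)
    (hμ : ∀ L : Submodule (IwasawaAlgebra 2) J.H,
      LinearMap.range ((I_W.loc J hsurj hγ hγᵥ).coprod (J_A.map uA J ∘ₗ I_A.loc J_A hsurj hγ hγᵥ)) ≤ L →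
      (∀ y ∈ L, (2 : IwasawaAlgebra 2) • y ∈
        LinearMap.range ((I_W.loc J hsurj hγ hγᵥ).coprod (J_A.map uA J ∘ₗ I_A.loc J_A hsurj hγ hγᵥ))) →
      muInvariant 2 DGr.X < muInvariant 2 (J.H ⧸ L))
    (S : ShapiroKatoGreenbergDatum I_W I_A J J' J_A uA hsurj hγ hγᵥ DGr Dfi L₀ L₀' b b') :
    S.gD ≤ lambdaInvariant 2 DGr.X :=
  ((isEmpty_shapiroKatoGreenbergDatum_of_forall_muInvariant_lt (Dfi := Dfi) (L₀ := L₀) (L₀' := L₀') (b := b) (b' := b')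
    hX hXt hμ).false S).elim

/-- **Target 6″ at a non-vacuous instance is the crux pair in `λ`-currency** (re-exhibit of the lead's kernel theorem p679569):
`S.gD ≤ λ(X_Gr) ↔ lam L₀ + lam L₀' ≤ b + b'`. [cite: GreenbergVatsal2000, §2 (shape only)] -/
theorem stub6''_iff_cruxPair (S : ShapiroKatoGreenbergDatum I_W I_A J J' J_A uA hsurj hγ hγᵥ DGr Dfi L₀ L₀' b b')
    (h : Module.Finite (IwasawaAlgebra 2) DGr.X ∧ Module.IsTorsion (IwasawaAlgebra 2) DGr.X) :
    S.gD ≤ lambdaInvariant 2 DGr.X ↔ lam L₀ + lam L₀' ≤ b + b' :=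
  S.gD_le_lambda_iff h

-- Target 4′ (re-exhibit of the landed kernel lemma, p680224): the v4.2 supply binder is refuted by any admissible `μ`-defect instance.
example := @pinnedKatoGreenbergSupplyAtTwo_false_of_muDefect
-- Target 4″ (v4.3; p680711): the typed `μ`-obligation on the Shapiro lattice of any supply witness.
example := @muInvariant_quotL_le_of_shapiroKatoGreenbergDatum

end LineKatoDeterminantGreenbergTwo

end Summit.BirchSwinnertonDyer.BirchSwinnertonDyer.Cruxes.OrdLambdaHalfAtTwo.Disproof

end
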